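import Mathlib
import Summits.NavierStokesRegularity.NavierStokesRegularity.Theses.EulerZoomLiouville
import Summits.NavierStokesRegularity.NavierStokesRegularity.Theorems.EulerZoomLiouvillePowerGaugeEulerLiouvilleBirthDefsFive
import Summits.NavierStokesRegularity.NavierStokesRegularity.Theorems.EulerZoomLiouvillePowerGaugeEulerLiouvilleSpiralTameWeakMember
import Summits.NavierStokesRegularity.NavierStokesRegularity.Theorems.EulerZoomLiouvillePowerGaugeEulerLiouvilleSpiralLocData
import Summits.NavierStokesRegularity.NavierStokesRegularity.Theorems.EulerZoomLiouvillePowerGaugeEulerLiouvilleLargeRho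
import Literature.Analysis.FluidPDE.SelfSimilarCollapseAnsatz
import Literature.Analysis.FluidPDE.VectorCalculus
import HarnessLib.Audit
import Summits.NavierStokesRegularity.NavierStokesRegularity.Theorems.EulerZoomLiouvillePowerGaugeEulerLiouvillePastTwisted
import Summits.NavierStokesRegularity.NavierStokesRegularity.Theorems.EulerZoomLiouvillePowerGaugeEulerLiouvilleSelfSimilarPastSubExtremal
import Summits.NavierStokesRegularity.NavierStokesRegularity.Theorems.EulerZoomLiouvillePowerGaugeEulerLiouvilleKillingRotation
import Summits.NavierStokesRegularity.NavierStokesRegularity.Theorems.EulerZoomLiouvillePowerGaugeEulerLiouvilleSelfSimilarPressureSlavingPast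

/-!
# Line `relative-equilibria` (ideator ns-idea-11 g6, lens «complete» = program-completion) for the crux
# `EulerZoomLiouville.PowerGaugeEulerLiouville` (stmt-NavierStokesRegularity-19832)

PROGRAMME COMPLETED.  The SYMMETRY CLASSIFICATION of candidate ancient/blow-up profiles — steady states, time-periodic
states, self-similar (SS) and discretely self-similar (DSS) profiles — has an AUTHOR-NAMED missing member: PERELMAN'S ROTATED
ANSATZ.  Chae–Tsai, *On discretely self-similar solutions of the Euler equations* (arXiv:1304.7414), p. 4: «A special case that
`V(y,s) = R(s k⃗) Ṽ(y)`, with `R(s k⃗)` being the rotation about a fixed axis `k⃗` by angle `s|k⃗|`, was proposed by G. Perelman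
[private communication of G. Seregin]. Then `Ṽ` satisfies a time-independent system.»  Pineau–Vicol, *A Liouville theorem for
rotated self similar solutions to the Navier–Stokes equations and applications* (arXiv:2607.09619, 2026), pp. 1–3, name the objects
— ROTATED SELF-SIMILAR (RSS) and ROTATED DISCRETELY SELF-SIMILAR (RDSS) solutions, «the equivalent of breathers in Perelman's
work» — and prove the NS Liouville theorem under Type I for extreme rotation rates only; the Euler side is untouched in print.
In the language of dynamics with symmetry these are the RELATIVE EQUILIBRIA of the similarity flow modulo the isometry group
`O(3)`: rigidly rotating steady states (relative equilibria), rotating time-periodic states (relative periodic orbits) and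
SPIRAL self-similar profiles (relative similarity equilibria, Perelman's ansatz).  The LEAD skeleton (birth v62) and the 18 seat
lines cover exactly the UNTWISTED slice (`IsPastSteady`, time-periodic branch of `IsWeakTamePast`, `IsPastSelfSimilar…`, the DSS
strata); this line files the `O(3)`-twisted slice.

THE LEVERS (why the twisted slice is attackable in Seregin's gauged class, and where it is not).
(L1) The three gauges `cknA`, `cknE`, `cknD` at the space–time origin are functionals of `|u|`, `‖∇u‖`, `|p|` on ORIGIN-CENTRED balls,
     hence invariant under `u(τ,·) ↦ Q u(τ, Q⁻¹·)` for ANY time-dependent linear isometry `Q = Q(τ)`: the E-gauge arithmetic that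
     kills steady and time-periodic pasts (tree: `PastSteady.ae_eq_zero_of_gauge_of_pastSteady`, `PastPeriodic.…_pastTimePeriodic`)
     kills their twisted versions verbatim (R1, `stub_twistedClock`).
(L2) For a spiral member `u(τ,x) = (T−τ)^{γ−1} e^{(log(T−τ))S} V(e^{−(log(T−τ))S}(T−τ)^{−γ}(x−x₀))`, `S` skew, `γ = 1/(2+ρ)`, the profile
     equation is `(1−γ)V − SV + (W_S·∇)V + ∇P = 0` with the SPIRAL WIND `W_S(y) = V(y) + γy + Sy`; since `tr S = 0` and `⟪Sy,y⟫ = 0`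
     (`inner_skew_self` below): `div W_S = 3γ`, the similarity-vorticity equation `(W_S·∇)Ω = (Ω·∇)W_S − (1+γ)Ω` and the Fermat
     exit condition of a backward `W_S`-orbit leaving a ball (`⟪y, V y⟫ ≤ −γ‖y‖²`, "fast inflow") are ALL FREE OF `S`, and so is
     the radially-tested local energy balance of the profile (the rotation transports `|V|²` along `Sy ⟂ ∇φ` for radial `φ`).  Hence the
     gauge-data-only ENERGY-SATURATION chain for sub-extremal profiles (`Past.selfSimilar_ae_eq_zero_of_subExtremal_past`, p607109:
     profile energy identity with radial cut-offs + pressure Poisson + scale ODE) ports to spiral profiles (R3, `stub_spiralSubExtremal`).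
(L2′) REV2 — THE CHEAPEST FALSIFIER OF R2, RUN (critic V47 P1; read of `Loc.volume_vortical_confined_eq_zero` and its kit): the LEAD's
     IRROTATIONAL-PIERCING kill of `C²` profiles (`Loc/Past.selfSimilar_ae_eq_zero_of_piercingIrrotationalC2_profile`, p613616/p618241)
     does NOT port as a whole.  Its Cauchy-formula, volume-growth (`e^{3γs}`) and harmonic-Liouville steps are `S`-free, but its
     LIMIT-SET step — confined backward half-orbits have square-integrable speed and accumulate at stagnation points BECAUSE the
     Bernoulli function is monotone along the wind (`…SelfSimilarHalfOrbitKit.bernoulli_comp_sub_eq_of_Ici`, `W·∇ℋ = (2γ−1)|W|²`) — is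
     exactly the identity that acquires the torque term of (L3): the spiral similarity flow is not gradient-like, confined backward
     orbits may be recurrent.  Its NODE step (thin bad nodes via `exists_thinBlock_of_curl_eq_zero_of_bad` /
     `exists_trappedSet_null_of_curl_ne_zero_loc`, cut on `curl U = 0 ∨ ∇U·curl U = curl U` for `U = W − γy`) meets `curl(V + Sy) = Ω + 2s`
     and must be re-cut on `re λ(∇W_S) ≶ 1 + γ` — repairable (`re λ ≤ λ_max(sym ∇V) + γ` is `S`-blind, so Cauchy's formula still empties
     the basin of a node with `max re λ < 1+γ`; a node with some `re λ ≥ 1+γ > 3γ = tr ∇W_S` has a backward-unstable direction).  So R2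
     (`stub_spiralTame`) is OPEN, NOT a port; its typed first lemma is `Sig.lemma_spiralVorticalEscape` below (at `S = 0` it is the tree's
     `Loc.volume_vortical_confined_eq_zero`).  What IS dead inside R2 today: classical spiral members with locally bounded `(u,∇u)` and
     small-`q` vorticity — spiral ⊂ DSS (factor `e^{2π/|S|}` in `ℝ³`), LEAD `IsDSSClassicalTame`.
(L3) NAMED GAP (the residue R4, `stub_spiralRest`, OPEN; by (L2′) the same identity also blocks R2's limit-set step): the LEAD's
     BERNOULLI-PIERCING upgrade (v48) does NOT port.  With
     `ℋ_S = ½|W_S|² + P − ½γ(1−γ)|y|² − ½|Sy|²` one finds `W_S·∇ℋ_S = (2γ−1)(|W_S|² − ⟪Sy, W_S⟫)`: the spinning similarity frame exerts the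
     Euler (angular-acceleration) force `(2γ−1)Sy`, which is divergence-free but NOT a gradient, so no Bernoulli function is monotone
     along the spiral wind in the far field `|Sy| ≳ |W_S|`.  SPIRAL NEEDLES — extremal `C²` spiral profiles with vortical fast inflow on
     all large spheres — are therefore a residue STRICTLY LARGER than the LEAD's `stub_selfSimilarC2Needle` (`S = 0`), and Perelman's
     question for Euler in the gauged class is exactly R4.
R5 (`stub_nonRelativeRest`, OPEN) is the complement of the stratum (members that are not relative equilibria of any of the three
kinds) — the crux restricted, not claimed.
CENSUS LABEL (rev2, critic V47 P2): twisted symmetry strata — R1 (twisted clocks) and R3 (sub-extremal spiral profiles) CLAIMED as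
ports (S/M), R2 (tame spiral profiles) OPEN with a typed first lemma, spiral needles R4 ⊋ the LEAD's `C²` needle OPEN, R5 OPEN;
width on the untwisted needle: 0.  Barrier note for BARRIERS.md (once R3's port confirms the dictionary): «no Bernoulli-type function
is monotone along a spinning similarity wind — torque `(2γ−1)⟪Sy, W_S⟫`».

REV3 (width): R1 `stub_twistedClock` is a TREE THEOREM — ns-ezl-w6 g2 p650280 `…Theorems.PowerGaugeEulerLiouville.Twisted.twistedClock_stratum`
(bodies verbatim, every `ρ > 0`) — wired term-mode; the skeleton's sorries are now exactly R2, R3, R4, R5.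

No summit is proved by a line: this file is a skeleton (stubs R1–R5 are `sorry`); its kernel-checked content is the composition
`PowerGaugeEulerLiouville_of`, the dictionary lemmas (`isPastSpiral_zero_iff`, `isPastTwistedSteady_of_pastSteady`,
`isPastTwistedPeriodic_of_pastTimePeriodic`, `spiralWind_zero`) and the algebra lemma `inner_skew_self`.

REV4 (g11, depth on R3): R3 `stub_spiralSubExtremal` is PROVED from ONE new stub R3a `Sig.stub_spiralLocData` (the spiral dictionary =
large-scale profile data of a spiral member: the port of `Past.exists_locData_of_past` + pressure slaving through the rotating frame,
local energy identity asked only for RADIAL-GRADIENT tests).  Proved in-file (kernel-checked, no `sorry`): `ae_eq_zero_of_subExtremal_loc_radial`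
(the tree's Bronzi–Shvydkoy endgame `EnergySaturation.ae_eq_zero_of_subExtremal_loc` verbatim with `hEE` weakened to radial-gradient
tests — the chain only ever tests with the rescaled radial cut-offs `σ(L⁻¹·)`), `spiral_ae_eq_zero_of_profile_ae_eq_zero` (null sets
pull back along `x ↦ e^{−sS}(T−τ)^{−γ}(x−x₀)`: `Killing.measurePreserving_expSkew` ∘ `Past.quasiMeasurePreserving_smul_sub`; then the
filled stratum `ae_eq_zero_of_gauge_of_energyVanishing_allRho`), `spiralSubExtremal_of_locData : Sig.stub_spiralLocData → Sig.stub_spiralSubExtremal`.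
The skeleton's sorries are now exactly R2, R3a, R4, R5; the statements of R1–R5 and the composition `PowerGaugeEulerLiouville_of` are unchanged.
REV4 ADDENDUM (cheapest falsifier of R3a's TYPING, run in-kernel): `spiralLocDataZeroCase_holds` — the `S = 0` case of `Sig.stub_spiralLocData` is PROVED from
tree theorems only (`PressureSlaving.inClass_pastSelfSimilarPressure` p635404 ∘ `Past.exists_locData_of_past` p607109, via `isPastSpiral_zero_iff`), and
`spiralLocDataZeroCase_of_stub` checks it is literally the stub's specialisation; so R3a's exponents / normalisations / threshold shapes are the tree's.
REV5 (g11, first brick of the R3a port PROVED in-file): `spiral_energy_growth_of_gaugeA_past` — recipe step P2, the spiral version of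
`Shifted.profile_energy_growth_of_gaugeA_past` (A-gauge ⇒ `∫_{B_L}‖V‖² ≤ C L^{1−2ρ}` for `L ≥ 2 − T₁`), same constant, for ANY skew `S`: the
untwisted proof verbatim with the rotated affine chart `x = x₀ + σ e^{(log s)S} y`, the rotation absorbed by `Killing.setLIntegral_ball_comp_expSkew`
+ `norm_twist_apply` (KEY ALGEBRA (i) of the card's recipe, now kernel-checked on a real brick).  Statements of R1–R5/R3a unchanged; sorries = R2, R3a, R4, R5.
REV6 (g12, second brick of the R3a port PROVED in-file — recipe step P3, section `SpiralGaugeE`): `spiral_profileGradient_ae_of_past` (the weak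
gradient of a spiral member is `λ^{−1} e^{(log λ)S} ∘ G(e^{−(log λ)S} λ^{−γ}(x − x₀)) ∘ e^{−(log λ)S}` a.e., `G` a weak derivative of the profile — the
spiral twin of `Past.exists_profileGradient_ae_of_past`: conjugated profile `R ∘ V ∘ R⁻¹`, `Twisted.hasWeakFDerivOn_conj`, uniqueness, transport),
`spiral_gradient_growth_of_gaugeE_past` (E-gauge ⇒ `∫_{B_L}|G|²_F ≤ C L^{1−ρ}` for `L ≥ 2 − T₁`, same constant as the untwisted
`Past.profile_gradient_growth_of_gaugeE_past`: Frobenius conjugation invariance + `Killing.setLIntegral_ball_comp_expSkew`), and the member-level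
`spiral_profileGradient_growth_of_past` = (E₁) of R3a for ANY skew `S`.  Statements of R1–R5/R3a unchanged; sorries = R2, R3a, R4, R5.
REV7 (g12, BY-NAME SWITCH to the LEAD's `Theorems/…BirthDefsFour.lean` p725060, commit 97d875c27f5e): the line's objects `IsSkew`, `twist`,
`IsPastSpiral`, `IsPastSpiralMember`, `IsSubExtremalProfile`, `HasRadialGradient` (and `E3`, `InClass`) are no longer local definitions — they are
the LEAD's `@[reducible]` binder predicates of namespace `…Theorems.PowerGaugeEulerLiouville.Birth` (copied there VERBATIM from this file and now
IMPORTED back by name), so R3 `Sig.stub_spiralSubExtremal` is literally the curried form of the v118 binder `Birth.IsPastSpiralSubExtremal ρ u`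
(`T₁ ≤ 0 ∧ T₁ ≤ T ∧ IsSkew S ∧ IsPastSpiral ρ T T₁ x₀ S u V ∧ IsSubExtremalProfile ρ V`) and R3a `Sig.stub_spiralLocData` is stated over the very
predicates the Theorems-side assembly `Spiral.exists_locData_of_pastSpiral` (ns-ezl-w1 g10, pending) unfolds.  No statement text changed (the deleted
local bodies were character-identical to the imported ones); every proof re-checked unchanged; sorries = R2, R3a, R4, R5.
REV8 (g12, ★ R3a FILLED FROM THE TREE ⇒ R3 SORRY-FREE): `stub_spiralLocData := Spiral.exists_locData_of_pastSpiral …` by name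
(`Theorems/…SpiralLocData.lean`, ns-ezl-w1 g10 p727126 — the Theorems-side spiral wave P2–P7/unify/ASM keyed by LEAD 19832 g16/g17 off this line's
R3a recipe; credits in the stub's docstring), hence the line's R3 `stub_spiralSubExtremal` («sub-extremal spiral members are trivial, any
regularity») no longer depends on any `sorry`; the LEAD's birth v118 (commit a7acbce54963) carries the same kill as binder #40
`¬ IsPastSpiralSubExtremal ρ u` / filled stub `stub_pastSpiralSubExtremal` (p727289).  OPEN stubs of the line are now R2 `stub_spiralTame`
(classical tame spiral profiles with S ≠ 0 — the spiral vortical-escape lemma), R4 `stub_spiralRest` (spiral needles / rough super-extremal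
profiles; not claimed) and R5 `stub_nonRelativeRest` (non-relative members; not claimed): sorries = R2, R4, R5.
REV9 (g12, birth v119 parity — R4 SPLIT BY NAME): the LEAD's last registration v119 (commit a0222d65cbc8; LAST of lineage ns-typeII-p2 under D-0168)
adds binder #41 `¬ IsPastSpiralTameWeak ρ u` (`Theorems/…BirthDefsFive.lean` p727264), filled by `Spiral.pastSpiralTameWeak_trivial` (ns-ezl-w3 g9,
p728352): spiral members of the four REGULARITY-FREE tameness senses (exterior `L^q` tail, irrotational far field ×2, integrable curl; `ρ < 1/2`)
are trivial.  That stratum lies inside this line's R4; REV9 records it BY NAME as R4a `Sig.stub_spiralTameWeak` (filled, no re-proof), leaves the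
residue R4b `Sig.stub_spiralRestB` (`… → ¬ IsPastSpiralTameWeak ρ u → VanishesAE u`, OPEN, not claimed) and proves R4 from the two by the case split
`spiralRest_of_split`; imports `…BirthDefsFive` (was `…Four`) + `…SpiralTameWeakMember`.  Statements of R1–R5/R3a UNCHANGED; `PowerGaugeEulerLiouville_of`
unchanged; sorries = R2 `stub_spiralTame`, R4b `stub_spiralRestB`, R5 `stub_nonRelativeRest`.
-/

noncomputable section

set_option linter.dupNamespace false

open MeasureTheory Set Filter Topology Metric Real
open scoped ENNReal NNReal RealInnerProductSpace
open Literature.Analysis Literature.Analysis.FluidPDE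

namespace Summit.NavierStokesRegularity.NavierStokesRegularity.Cruxes.PowerGaugeEulerLiouville.RelativeEquilibria

open Summit.NavierStokesRegularity.NavierStokesRegularity.Theorems.PowerGaugeEulerLiouville.Birth

/-! ## Imported objects (since REV7): `E3`, `InClass`, `IsSkew`, `twist`, `IsPastSpiral`, `IsPastSpiralMember`, `IsSubExtremalProfile`,
`HasRadialGradient` are the LEAD's `Birth.*` predicates of `Theorems/…BirthDefs{,Four}.lean` (this line's REV1–REV6 definitions, moved to the
tree verbatim by LEAD 19832 g17, p725060); `IsPastSpiralSubExtremal ρ u` (the v118 binder) packages R3's hypotheses. -/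

/-- The conclusion of the crux: `u` vanishes a.e. on the past slab. -/
@[reducible] def VanishesAE (u : ℝ → E3 → E3) : Prop :=
  Function.uncurry u =ᵐ[volume.restrict (Set.Iio (0 : ℝ) ×ˢ (Set.univ : Set E3))] 0

/-! ## The objects: relative equilibria of the similarity dynamics modulo `O(3)` -/

/-- RELATIVE EQUILIBRIUM (twisted-steady past): on a past sub-slab `τ < T₁ ≤ 0` every slice is an isometric conjugate of ONE state,
`u(τ) = Q_τ ∘ v ∘ Q_τ⁻¹` — rigidly rotating / precessing steady states; the isometry path `τ ↦ Q_τ` is arbitrary (the kill uses only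
the isometry invariance of the gauges slice by slice: the `Q_τ` are LINEAR isometries, they fix the origin, so the origin-centred balls
and cylinders of the three gauges are `Q_τ`-invariant and `cknA/cknE/cknD` at centre `0` are unchanged).  `Q ≡ 1` is the LEAD's
`IsPastSteady`. -/
def IsPastTwistedSteady (u : ℝ → E3 → E3) : Prop :=
  ∃ (T₁ : ℝ) (v : E3 → E3) (Q : ℝ → (E3 ≃ₗᵢ[ℝ] E3)), T₁ ≤ 0 ∧
    ∀ τ : ℝ, τ < T₁ → u τ = fun x => Q τ (v ((Q τ).symm x))

/-- RELATIVE PERIODIC ORBIT (twisted-periodic past): `u(τ) = L ∘ u(τ − P) ∘ L⁻¹` for `τ < T₁ ≤ 0`, some period `P > 0` and ONE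
isometry `L` — rotating waves / states periodic up to a rotation.  `L = 1` is the time-periodic branch of the LEAD's `IsWeakTamePast`. -/
def IsPastTwistedPeriodic (u : ℝ → E3 → E3) : Prop :=
  ∃ (T₁ P : ℝ) (L : E3 ≃ₗᵢ[ℝ] E3), T₁ ≤ 0 ∧ 0 < P ∧
    ∀ τ : ℝ, τ < T₁ → u τ = fun x => L (u (τ - P) (L.symm x))

/-- IRROTATIONAL PIERCING (the PRESSURE-FREE first disjunct of the LEAD's `HasBernoulliPiercing`, the part that survives the twist):
beyond every radius there is a sphere on which every FAST-INFLOW point `⟪y, V y⟫ ≤ −‖y‖²/(2+ρ)` is irrotational.  Vacuous — hence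
satisfied — for profiles with `|V(y)| < ‖y‖/(2+ρ)` near infinity (bounded, sub-linear, `o(|y|)`). -/
def HasIrrotationalPiercing (ρ : ℝ) (V : E3 → E3) : Prop :=
  ∀ R₀ : ℝ, ∃ R : ℝ, R₀ ≤ R ∧ ∀ y : E3, ‖y‖ = R →
    inner ℝ y (V y) ≤ -(1 / (2 + ρ) * ‖y‖ ^ 2) → curl V y = 0

/-- TAME `C²` spiral profile: `C²` and EITHER uniformly continuous OR with irrotational piercing (the `S`-robust part of the LEAD's
`IsTameC2Profile`; its Bernoulli disjunct is the named gap L3). -/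
def IsSpiralTameProfile (ρ : ℝ) (V : E3 → E3) : Prop :=
  ContDiff ℝ 2 V ∧ (UniformContinuous V ∨ HasIrrotationalPiercing ρ V)

/-! ## Registered stub signatures -/

/-- R1 (S/M — TWISTED CLOCKS, lever L1): relative equilibria and relative periodic orbits are trivial.  Plan: the slice functionals
`r ↦ ∫_{B_r}‖H(τ)‖²` are `τ`-constant (resp. `P`-periodic) on `(−∞,T₁)` by isometry invariance; the E-gauge `∫_{−T}^{0}∫_{B_{√T}}‖H‖² ≤ c T^{(1−ρ)/2}`
is sub-linear in `T`, so they vanish; `H = 0` a.e. on the window ⇒ slices a.e. constant ⇒ zero by the A-gauge ⇒ energy-quiescent past ⇒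
`ae_eq_zero_of_gauge_of_energyVanishing_allRho` (pattern: p597049, p599372). -/
def Sig.stub_twistedClock : Prop :=
  ∀ ρ : ℝ, 0 < ρ → ρ ≤ 1 / 2 → ∀ (u : ℝ → E3 → E3) (p : ℝ → E3 → ℝ) (H : ℝ → E3 → E3 →L[ℝ] E3) (c : ℝ≥0),
    InClass ρ u p H c → (IsPastTwistedSteady u ∨ IsPastTwistedPeriodic u) → VanishesAE u

/-- R2 (OPEN — TAME SPIRAL PROFILES; rev2: NOT a port, the V47 P1 falsifier bit, see (L2′)): a spiral member with a tame `C²`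
profile is trivial.  What survives of the plan: weak ⇒ classical spiral profile system `(1−γ)V − SV + (W_S·∇)V + ∇P′ = 0`, `div V = 0`
(pattern `WeakToClassical.exists_isSelfSimilarEulerProfile_of_contDiff` with the extra Lie-derivative term); the uniformly continuous
case ⇒ irrotational piercing by the A-gauge growth `∫_{B_R}|V|² ≤ c R^{1−2ρ}` (gauge-only, `S`-free, LEAD v43); Cauchy's formula along
the spiral wind `(W_S·∇)Ω = (Ω·∇)W_S − (1+γ)Ω`, `div W_S = 3γ`, fast-inflow exit points (`⟪Sy,y⟫ = 0`), harmonic Liouville — all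
`S`-free.  What does NOT survive: the limit-set step of the confined-orbit lemma `Loc.volume_vortical_confined_eq_zero` (Bernoulli
monotonicity along the wind, `HalfOrbitKit.bernoulli_comp_sub_eq_of_Ici`) — torque term, no Lyapunov function, recurrent confined
orbits not excluded; and its node step must be re-cut on `re λ(∇V + γ·1 + S) ≶ 1+γ` (repairable).  FIRST LEMMA (typed, critic V47
P1): `Sig.lemma_spiralVorticalEscape` — vortical points of a `C²` spiral profile with a confined backward `W_S`-half-orbit are null;
OPEN for `S ≠ 0` (no gradient-like structure), the tree theorem at `S = 0`.  In `ℝ³` every spiral member with `S ≠ 0` is DSS with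
factor `e^{2π/|S|}`, so classical members with locally bounded `(u,∇u)` and small-`q` or compactly supported vorticity are ALREADY
dead by the LEAD's `IsDSSClassicalTame` / `IsDSSCompactVorticity`; this stub asks neither. -/
def Sig.stub_spiralTame : Prop :=
  ∀ ρ : ℝ, 0 < ρ → ρ ≤ 1 / 2 → ∀ (u : ℝ → E3 → E3) (p : ℝ → E3 → ℝ) (H : ℝ → E3 → E3 →L[ℝ] E3) (c : ℝ≥0)
    (T T₁ : ℝ) (x₀ : E3) (S : E3 →L[ℝ] E3) (V : E3 → E3),
    InClass ρ u p H c → T₁ ≤ 0 → T₁ ≤ T → IsSkew S → IsPastSpiral ρ T T₁ x₀ S u V →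
      IsSpiralTameProfile ρ V → VanishesAE u

/-- The SPIRAL WIND of a profile `V` with similarity rate `γ` and spin generator `S`: `W_S(y) = V(y) + γy + Sy`
(`S = 0`: the Literature's `selfSimilarTransport γ 0 V`). -/
def spiralWind (γ : ℝ) (S : E3 →L[ℝ] E3) (V : E3 → E3) (y : E3) : E3 :=
  V y + γ • y + S y

/-- CLASSICAL SPIRAL PROFILE SYSTEM (Perelman ansatz inserted in Euler): `V ∈ C²`, `P ∈ C¹`, `div V = 0` and
`(1−γ)V − SV + (W_S·∇)V + ∇P = 0` pointwise.  `S = 0`: CIV (3.3), the Literature's `IsSelfSimilarEulerProfile γ 0 V P` (classical form). -/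
def IsSpiralProfile (γ : ℝ) (S : E3 →L[ℝ] E3) (V : E3 → E3) (P : E3 → ℝ) : Prop :=
  ContDiff ℝ 2 V ∧ ContDiff ℝ 1 P ∧
    (∀ y : E3, LinearMap.trace ℝ E3 ((fderiv ℝ V y : E3 →L[ℝ] E3) : E3 →ₗ[ℝ] E3) = 0) ∧
    ∀ y : E3, (1 - γ) • V y - S (V y) + fderiv ℝ V y (spiralWind γ S V y) + gradient P y = 0

/-- FIRST LEMMA OF R2 (typed, not a stub of the composition; critic V47 P1): SPIRAL VORTICAL ESCAPE — in a `C²` spiral profile with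
`0 < γ < ½` and `S` skew, for every `N > 0` the set of VORTICAL points (`curl V x ≠ 0`) admitting a backward `W_S`-half-orbit
(`Y 0 = x`, `Y' = −W_S(Y)` on `[0,∞)`) confined to `‖y‖ ≤ N` is Lebesgue-null.  `S = 0`: the tree's
`Loc.volume_vortical_confined_eq_zero` (its proof uses Bernoulli monotonicity at the limit-set step and does not port); `S ≠ 0`: OPEN —
the honest content of R2.  A refuter kills it with a `C²` spiral profile carrying a vortical recurrent confined orbit of its similarity
flow (linear profiles `V = Ay` cannot: a vortical one has `(A+S)Ω = Ω`, transverse rates `re λ = (2γ−1)/2 < 0`). -/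
def Sig.lemma_spiralVorticalEscape : Prop :=
  ∀ (γ : ℝ), 0 < γ → γ < 1 / 2 → ∀ (S : E3 →L[ℝ] E3) (V : E3 → E3) (P : E3 → ℝ), IsSkew S → IsSpiralProfile γ S V P →
    ∀ N : ℝ, 0 < N →
      volume {x : E3 | curl V x ≠ 0 ∧
        ∃ Y : ℝ → E3, Y 0 = x ∧ (∀ t : ℝ, 0 ≤ t → HasDerivAt Y ((-1 : ℝ) • spiralWind γ S V (Y t)) t) ∧
          ∀ t : ℝ, 0 ≤ t → ‖Y t‖ ≤ N} = 0

/-- R3 (M — SUB-EXTREMAL SPIRAL PROFILES, lever L1): a spiral member whose profile energy is sub-extremal is trivial, for profiles of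
ANY regularity.  Plan: every radial-cutoff energy/flux/pressure quantity of the spiral member about `x₀` equals that of the untwisted
collapse of `(V, P)` (isometry invariance slice by slice); the spiral profile's local energy identity tested against RADIAL cut-offs
coincides with the self-similar one (`⟪SV,V⟫ = 0`, `∫|V|²(Sy·∇σ) = 0` for radial `σ`) and its pressure solves the SAME Poisson equation
`−ΔP = ∂ᵢ∂ⱼ(VᵢVⱼ)` (`div(−SV + (Sy·∇)V) = 0`), so the Bronzi–Shvydkoy energy-saturation chain (`EnergySaturationMember.selfSimilar_ae_eq_zero_of_subExtremal`,
`Past.selfSimilar_ae_eq_zero_of_subExtremal_past` p607109) ports — porting risk: any NON-radial test used inside the chain picks up the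
torque term `−½∫|V|²(Sy·∇σ)`. -/
def Sig.stub_spiralSubExtremal : Prop :=
  ∀ ρ : ℝ, 0 < ρ → ρ ≤ 1 / 2 → ∀ (u : ℝ → E3 → E3) (p : ℝ → E3 → ℝ) (H : ℝ → E3 → E3 →L[ℝ] E3) (c : ℝ≥0)
    (T T₁ : ℝ) (x₀ : E3) (S : E3 →L[ℝ] E3) (V : E3 → E3),
    InClass ρ u p H c → T₁ ≤ 0 → T₁ ≤ T → IsSkew S → IsPastSpiral ρ T T₁ x₀ S u V →
      IsSubExtremalProfile ρ V → VanishesAE u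

/-- R3 IS THE LEAD's v118 STRATUM (REV7, kernel-checked bookkeeping): `Sig.stub_spiralSubExtremal` is — up to currying — the member-level
statement over the binder `Birth.IsPastSpiralSubExtremal ρ u` of `Theorems/…BirthDefsFour.lean` (the hypothesis of the skeleton's v118 stub
`stub_pastSpiralSubExtremal`). [folklore] -/
theorem Sig.stub_spiralSubExtremal_iff_member :
    Sig.stub_spiralSubExtremal ↔
      ∀ ρ : ℝ, 0 < ρ → ρ ≤ 1 / 2 → ∀ (u : ℝ → E3 → E3) (p : ℝ → E3 → ℝ) (H : ℝ → E3 → E3 →L[ℝ] E3) (c : ℝ≥0),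
        InClass ρ u p H c → IsPastSpiralSubExtremal ρ u → VanishesAE u := by
  constructor
  · intro h ρ hρ hρh u p H c hcl hsp
    obtain ⟨T, T₁, x₀, S, V, hT₁, hTT₁, hS, hu, hsub⟩ := hsp
    exact h ρ hρ hρh u p H c T T₁ x₀ S V hcl hT₁ hTT₁ hS hu hsub
  · intro h ρ hρ hρh u p H c T T₁ x₀ S V hcl hT₁ hTT₁ hS hu hsub
    exact h ρ hρ hρh u p H c hcl ⟨T, T₁, x₀, S, V, hT₁, hTT₁, hS, hu, hsub⟩

/-- R4 (OPEN residue — SPIRAL NEEDLES and rough spiral profiles, the named gap L3; not claimed): spiral members whose profile is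
neither tame-`C²` nor sub-extremal are trivial.  For `S = 0` this is the LEAD's `stub_selfSimilarC2Needle ∪ stub_selfSimilarWeakRest`;
for `S ≠ 0` it is strictly larger (no Bernoulli monotonicity along the spiral wind: torque term `(2γ−1)⟪Sy, W_S⟫`).  Perelman's question
for Euler in the gauged class. -/
def Sig.stub_spiralRest : Prop :=
  ∀ ρ : ℝ, 0 < ρ → ρ ≤ 1 / 2 → ∀ (u : ℝ → E3 → E3) (p : ℝ → E3 → ℝ) (H : ℝ → E3 → E3 →L[ℝ] E3) (c : ℝ≥0)
    (T T₁ : ℝ) (x₀ : E3) (S : E3 →L[ℝ] E3) (V : E3 → E3),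
    InClass ρ u p H c → T₁ ≤ 0 → T₁ ≤ T → IsSkew S → IsPastSpiral ρ T T₁ x₀ S u V →
      ¬ IsSpiralTameProfile ρ V → ¬ IsSubExtremalProfile ρ V → VanishesAE u

/-- R4a [FILLED BY NAME (REV9, birth v119 parity) — the four REGULARITY-FREE spiral tameness senses]: spiral members satisfying the member
predicate `Birth.IsPastSpiralTameWeak ρ u` (`Theorems/…BirthDefsFive.lean`, p727264: `ρ < 1/2` and the rotated profile has an `L^q` exterior
tail with `2 ≤ q ≤ 3/(1+ρ)`, or a symmetric weak gradient far out (irrotational far field), or is weakly irrotational far out, or has integrable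
`L¹ ∩ L²` curl) are trivial — the tree theorem `Spiral.pastSpiralTameWeak_trivial` (ns-ezl-w3 g9, p728352; = the LEAD's 41st binder, v119).
This carves the regularity-free part out of R4; it is recorded here BY NAME, not re-proved. -/
def Sig.stub_spiralTameWeak : Prop :=
  ∀ ρ : ℝ, 0 < ρ → ρ ≤ 1 / 2 → ∀ (u : ℝ → E3 → E3) (p : ℝ → E3 → ℝ) (H : ℝ → E3 → E3 →L[ℝ] E3) (c : ℝ≥0),
    InClass ρ u p H c → IsPastSpiralTameWeak ρ u → VanishesAE u

/-- R4b (OPEN residue of R4 after REV9 — not claimed): spiral members whose profile is neither tame-`C²` nor sub-extremal AND which satisfy none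
of the four regularity-free tameness senses (`¬ IsPastSpiralTameWeak ρ u`): the spiral NEEDLES proper and the rough super-extremal spiral profiles.
For `S = 0` this is contained in the LEAD's `stub_selfSimilarC2Needle ∪ stub_selfSimilarWeakRest` (birth v119). -/
def Sig.stub_spiralRestB : Prop :=
  ∀ ρ : ℝ, 0 < ρ → ρ ≤ 1 / 2 → ∀ (u : ℝ → E3 → E3) (p : ℝ → E3 → ℝ) (H : ℝ → E3 → E3 →L[ℝ] E3) (c : ℝ≥0)
    (T T₁ : ℝ) (x₀ : E3) (S : E3 →L[ℝ] E3) (V : E3 → E3),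
    InClass ρ u p H c → T₁ ≤ 0 → T₁ ≤ T → IsSkew S → IsPastSpiral ρ T T₁ x₀ S u V →
      ¬ IsSpiralTameProfile ρ V → ¬ IsSubExtremalProfile ρ V → ¬ IsPastSpiralTameWeak ρ u → VanishesAE u

/-- The REV9 seam: R4 from R4a (by name) and the residue R4b — a case split on the member predicate, nothing else. -/
theorem spiralRest_of_split (ha : Sig.stub_spiralTameWeak) (hb : Sig.stub_spiralRestB) : Sig.stub_spiralRest := by
  intro ρ hρ hρh u p H c T T₁ x₀ S V hcl hT₁ hTT₁ hS hu hnt hns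
  by_cases hw : IsPastSpiralTameWeak ρ u
  · exact ha ρ hρ hρh u p H c hcl hw
  · exact hb ρ hρ hρh u p H c T T₁ x₀ S V hcl hT₁ hTT₁ hS hu hnt hns hw

/-- R5 (OPEN residue — the complement of the stratum; not claimed): members that are relative equilibria of NONE of the three kinds
are trivial (the crux restricted; contains every untwisted non-symmetric candidate). -/
def Sig.stub_nonRelativeRest : Prop :=
  ∀ ρ : ℝ, 0 < ρ → ρ ≤ 1 / 2 → ∀ (u : ℝ → E3 → E3) (p : ℝ → E3 → ℝ) (H : ℝ → E3 → E3 →L[ℝ] E3) (c : ℝ≥0),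
    InClass ρ u p H c → ¬ IsPastTwistedSteady u → ¬ IsPastTwistedPeriodic u → ¬ IsPastSpiralMember ρ u → VanishesAE u

/-! ## R3 one level down (rev4, g11): the RADIAL energy-saturation endgame, PROVED; the spiral dictionary isolated as stub R3a

The Bronzi–Shvydkoy sub-extremal chain (`EnergySaturation.ae_eq_zero_of_subExtremal_loc`, tree) consumes the profile's local energy
equality ONLY through the rescaled RADIAL cut-offs `σ(L⁻¹·)` of `exists_radialCutoff` (`∇σ(z) = −k(z) z`).  For a SPIRAL profile the
local energy identity tested with `θ` carries the extra torque/transport term `−½∫|V|²⟪Sy, ∇θ⟫`, which vanishes identically when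
`∇θ(z) ∥ z` (`⟪Sz, z⟫ = 0`).  So the endgame below asks the identity only for tests with RADIAL GRADIENT (`HasRadialGradient`) — it is
the tree proof verbatim with that one hypothesis weakened — and the whole `S`-dependence of R3 is confined to the dictionary stub
R3a `Sig.stub_spiralLocData` (large-scale profile data of a spiral member: the port of `Past.exists_locData_of_past` +
`PressureSlaving.inClass_pastSelfSimilarPressure` through the rotating frame).  Null sets pull back along the slice maps
`x ↦ e^{−sS}(T−τ)^{−γ}(x − x₀)` (rotations preserve Lebesgue measure: `Killing.measurePreserving_expSkew`), so `V = 0` a.e. makes the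
past energy-quiescent and the filled stratum `ae_eq_zero_of_gauge_of_energyVanishing_allRho` ends it
(`spiral_ae_eq_zero_of_profile_ae_eq_zero`).  Composition: `spiralSubExtremal_of_locData : Sig.stub_spiralLocData → Sig.stub_spiralSubExtremal`
(kernel-checked), and `stub_spiralSubExtremal` is now PROVED from R3a. -/

section SpiralEndgame

open Function TopologicalSpace
open scoped ContDiff Laplacian InnerProductSpace
open Literature.Analysis.FunctionSpaces
open Summit.NavierStokesRegularity.NavierStokesRegularity.Theorems.PowerGaugeEulerLiouville
open Summit.NavierStokesRegularity.NavierStokesRegularity.Theorems.PowerGaugeEulerLiouville.EnergySaturation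

/-- R3a (PORT, L — THE SPIRAL DICTIONARY; rev4, the only `S`-dependent step of R3): the LARGE-SCALE PROFILE DATA of a spiral member.
For a member of the class whose velocity is a Perelman spiral about `(T, x₀)` with skew generator `S` and profile `V` for `τ < T₁`
(`T₁ ≤ 0`, `T₁ ≤ T`), there are a profile pressure `P`, a profile gradient `G` and ONE constant `c'` with: `V`, `P`, `G`
a.e.-strongly measurable, `G` a weak derivative of `V`, the growth bounds (A₁) `∫_{B_L}|V|² ≤ c' L^{1−2ρ}`, (E₁)
`∫_{B_L}|G|²_F ≤ L^{1−ρ}((1−ρ)/(2+ρ))c'`, (D₁) `∫_{B_L}|P|^{3/2} ≤ L^{2−2ρ}((2−2ρ)/(2+ρ))c'` for `L ≥ 1`, the weak pressure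
Poisson equation `∫PΔθ = −∫D²θ(V,V)`, and the profile local energy identity for every test `θ` WITH RADIAL GRADIENT.
`S = 0`: verbatim `Past.exists_locData_of_past` after pressure slaving (tree).  Plan of the port: slaved pressure of a spiral velocity
is spiral (uniqueness + rotation/scaling covariance of `−Δp = ∂ᵢ∂ⱼ(uᵢuⱼ)`); (A₁)/(E₁)/(D₁) slice by slice — the slice map is a
translated dilation composed with a linear ISOMETRY, origin-centred balls go to balls of the same radii with ROTATED centres
`−(T−τ)^{−γ}e^{−sS}x₀` of the same norms, Frobenius norms are conjugation invariant; Poisson by covariance; the local energy identity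
of the member tested with `χ(τ)θ_L(x − x₀)` in profile variables produces `∂_τ` ↦ `γ⟪y,∇θ⟫ + ⟪Sy,∇θ⟫`, and the second term is
zero for radial-gradient `θ`.  Why it might fail: only by mis-typing (exponent/normalisation conventions of `IsPastSpiral`); the
content is an isometric re-description slice by slice.  [folklore; BronziShvydkoy2015 Thm 1.1; Seregin2025 arXiv:2507.08733 §§3–4] -/
def Sig.stub_spiralLocData : Prop :=
  ∀ ρ : ℝ, 0 < ρ → ρ ≤ 1 / 2 → ∀ (u : ℝ → E3 → E3) (p : ℝ → E3 → ℝ) (H : ℝ → E3 → E3 →L[ℝ] E3) (c : ℝ≥0)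
    (T T₁ : ℝ) (x₀ : E3) (S : E3 →L[ℝ] E3) (V : E3 → E3),
    InClass ρ u p H c → T₁ ≤ 0 → T₁ ≤ T → IsSkew S → IsPastSpiral ρ T T₁ x₀ S u V →
      ∃ (P : E3 → ℝ) (G : E3 → E3 →L[ℝ] E3) (c' : ℝ≥0),
        AEStronglyMeasurable V volume ∧ AEStronglyMeasurable P volume ∧ AEStronglyMeasurable G volume ∧
        HasWeakFDerivOn (⊤ : TopologicalSpace.Opens E3) volume V G ∧
        (∀ L : ℝ, 1 ≤ L → ∫⁻ y in Metric.ball (0 : E3) L, ‖V y‖ₑ ^ 2 ≤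
          (c' : ℝ≥0∞) * ENNReal.ofReal (L ^ (1 - 2 * ρ))) ∧
        (∀ L : ℝ, 1 ≤ L →
          ∫⁻ y in Metric.ball (0 : E3) L, ENNReal.ofReal (frobeniusNormSq (G y)) ≤
            ENNReal.ofReal (L ^ (1 - ρ)) * (ENNReal.ofReal ((1 - ρ) / (2 + ρ)) * (c' : ℝ≥0∞))) ∧
        (∀ L : ℝ, 1 ≤ L →
          ∫⁻ y in Metric.ball (0 : E3) L, ‖P y‖ₑ ^ (3 / 2 : ℝ) ≤
            ENNReal.ofReal (L ^ (2 - 2 * ρ)) * (ENNReal.ofReal ((2 - 2 * ρ) / (2 + ρ)) * (c' : ℝ≥0∞))) ∧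
        (∀ θ : E3 → ℝ, ContDiff ℝ (⊤ : ℕ∞) θ → HasCompactSupport θ →
          ∫ y, P y * (Δ θ) y = -∫ y, fderiv ℝ (fderiv ℝ θ) y (V y) (V y)) ∧
        (∀ θ : E3 → ℝ, IsTestFunctionOn (⊤ : TopologicalSpace.Opens E3) θ → HasRadialGradient θ →
          (2 - 5 * (1 / (2 + ρ))) * ∫ x, θ x * ‖V x‖ ^ 2 =
            (∫ x, (‖V x‖ ^ 2 + 2 * P x) * ⟪V x, gradient θ x⟫) +
              (1 / (2 + ρ)) * ∫ x, ‖V x‖ ^ 2 * ⟪x, gradient θ x⟫)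

/-- A gradient given by `⟪w, ∇σ(z)⟫ = −k(z)⟪w, z⟫` (the `k`-clause of `exists_radialCutoff`) is radial. -/
theorem hasRadialGradient_of_inner {σ : E3 → ℝ} {k : E3 → ℝ}
    (hk : ∀ z w : E3, ⟪w, gradient σ z⟫ = -(k z * ⟪w, z⟫)) : HasRadialGradient σ := by
  intro z
  refine ⟨-k z, ext_inner_left ℝ fun w => ?_⟩
  rw [hk z w, real_inner_smul_right]
  ring

/-- Rescaling preserves radial gradients: `∇(σ(L⁻¹·))(z) = L⁻¹∇σ(L⁻¹z) ∥ z`. -/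
theorem hasRadialGradient_comp_inv_smul {σ : E3 → ℝ} (hσ : Differentiable ℝ σ) (hrad : HasRadialGradient σ) (L : ℝ) :
    HasRadialGradient (fun z => σ (L⁻¹ • z)) := by
  intro z
  obtain ⟨m, hm⟩ := hrad (L⁻¹ • z)
  refine ⟨L⁻¹ * m * L⁻¹, ?_⟩
  rw [gradient_comp_inv_smul hσ L z, hm, smul_smul, smul_smul]

/-- **The large-scale sub-extremal dichotomy with the local energy identity asked ONLY for radial-gradient tests** — the tree's
`EnergySaturation.ae_eq_zero_of_subExtremal_loc` verbatim with `hEE` weakened to `HasRadialGradient θ →`: the proof uses the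
identity only for the rescaled radial cut-offs `σ(L⁻¹·)`.  Profile data `(V, P, G, c)` in the shapes (A₁), (E₁), (D₁) for `L ≥ 1`,
weak pressure Poisson equation, radial local energy identity, and `liminf_{L→∞} L^{2ρ−1}∫_{B_L}|V|² = 0` ⇒ `V = 0` a.e.
(`0 < ρ < 1`). [folklore; cf. BronziShvydkoy2015 Thm 1.1] -/
theorem ae_eq_zero_of_subExtremal_loc_radial {ρ : ℝ} (hρ : 0 < ρ) (hρ1 : ρ < 1)
    {V : E3 → E3} {P : E3 → ℝ} {G : E3 → E3 →L[ℝ] E3}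
    (hVm : AEStronglyMeasurable V volume) (hPm : AEStronglyMeasurable P volume)
    (hGm : AEStronglyMeasurable G volume)
    (hVG : HasWeakFDerivOn (⊤ : Opens (EuclideanSpace ℝ (Fin 3))) volume V G) {c : ℝ≥0}
    (hA : ∀ L : ℝ, 1 ≤ L → ∫⁻ y in ball (0 : EuclideanSpace ℝ (Fin 3)) L, ‖V y‖ₑ ^ 2 ≤
      (c : ℝ≥0∞) * ENNReal.ofReal (L ^ (1 - 2 * ρ)))
    (hE : ∀ L : ℝ, 1 ≤ L →
      ∫⁻ y in ball (0 : EuclideanSpace ℝ (Fin 3)) L, ENNReal.ofReal (frobeniusNormSq (G y)) ≤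
        ENNReal.ofReal (L ^ (1 - ρ)) * (ENNReal.ofReal ((1 - ρ) / (2 + ρ)) * (c : ℝ≥0∞)))
    (hD : ∀ L : ℝ, 1 ≤ L →
      ∫⁻ y in ball (0 : EuclideanSpace ℝ (Fin 3)) L, ‖P y‖ₑ ^ (3 / 2 : ℝ) ≤
        ENNReal.ofReal (L ^ (2 - 2 * ρ)) * (ENNReal.ofReal ((2 - 2 * ρ) / (2 + ρ)) * (c : ℝ≥0∞)))
    (hPoisson : ∀ θ : EuclideanSpace ℝ (Fin 3) → ℝ, ContDiff ℝ (⊤ : ℕ∞) θ → HasCompactSupport θ →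
      ∫ y, P y * (Δ θ) y = -∫ y, fderiv ℝ (fderiv ℝ θ) y (V y) (V y))
    (hEE : ∀ θ : EuclideanSpace ℝ (Fin 3) → ℝ, IsTestFunctionOn (⊤ : Opens (EuclideanSpace ℝ (Fin 3))) θ →
      HasRadialGradient θ →
      (2 - 5 * (1 / (2 + ρ))) * ∫ x, θ x * ‖V x‖ ^ 2 =
        (∫ x, (‖V x‖ ^ 2 + 2 * P x) * ⟪V x, gradient θ x⟫) +
          (1 / (2 + ρ)) * ∫ x, ‖V x‖ ^ 2 * ⟪x, gradient θ x⟫)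
    (hsub : ∀ ε : ℝ, 0 < ε → ∀ L₀ : ℝ, ∃ L : ℝ, L₀ ≤ L ∧
      L ^ (2 * ρ - 1) * ∫ y in ball (0 : EuclideanSpace ℝ (Fin 3)) L, ‖V y‖ ^ 2 < ε) :
    V =ᵐ[volume] 0 := by
  have hc0 : (0 : ℝ) ≤ c := c.2
  have hV2 : LocallyIntegrable (fun y => ‖V y‖ ^ 2) volume := locallyIntegrable_norm_sq_of_growth_loc hVm hA
  -- the radial cut-off (its `k`-clause is KEPT: the rescaled cut-offs have radial gradient)
  obtain ⟨σ, hσs, hσc, h0, h1, hone, hzero, k, -, hk⟩ := exists_radialCutoff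
  have hσ : IsTestFunctionOn (⊤ : Opens (EuclideanSpace ℝ (Fin 3))) σ := ⟨hσs, hσc, fun _ _ => trivial⟩
  have hσd : Differentiable ℝ σ := hσs.differentiable (by simp)
  have hσrad : HasRadialGradient σ := hasRadialGradient_of_inner hk
  have hEEσ : ∀ L : ℝ, 0 < L → (2 - 5 * (1 / (2 + ρ))) * ∫ x, σ (L⁻¹ • x) * ‖V x‖ ^ 2 =
      (∫ x, (‖V x‖ ^ 2 + 2 * P x) * ⟪V x, gradient (fun z => σ (L⁻¹ • z)) x⟫) +
        (1 / (2 + ρ)) * ∫ x, ‖V x‖ ^ 2 * ⟪x, gradient (fun z => σ (L⁻¹ • z)) x⟫ :=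
    fun L hL => hEE _ (isTestFunctionOn_comp_inv_smul hσ hL.ne') (hasRadialGradient_comp_inv_smul hσd hσrad L)
  -- the normalised energy `N`
  set N : ℝ → ℝ := fun R => R ^ (2 * ρ - 1) * ∫ y, σ (R⁻¹ • y) * ‖V y‖ ^ 2 with hN
  have hN0 : ∀ R, 0 < R → 0 ≤ N R := fun R hR =>
    mul_nonneg (Real.rpow_nonneg hR.le _) (integral_nonneg fun y => mul_nonneg (h0 _) (sq_nonneg _))
  have hN3 : ∀ R, 1 ≤ R → N R ≤ 3 * c := by
    intro R hR
    have h := normEnergy_le_of_growth_loc (ρ := ρ) h0 h1 hzero hVm hA hR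
    have h3 : (3 : ℝ) ^ (1 - 2 * ρ) ≤ 3 := by
      conv_rhs => rw [← Real.rpow_one 3]
      exact Real.rpow_le_rpow_of_exponent_le (by norm_num) (by linarith)
    exact h.trans (by gcongr)
  -- the flux weight bound and the tail estimate
  obtain ⟨A, hA0, hflux⟩ := exists_fluxWeight_le_of_sup_loc hρ hρ1 hσ h0 h1 hone hzero hVm hPm hGm hVG hA hE hD
    hPoisson
  set a : ℝ := (2 + ρ) / 4 with hadef
  have ha0 : 0 < a := by rw [hadef]; positivity
  set B₀ : ℝ := A / a with hB₀
  have hB₀0 : 0 ≤ B₀ := div_nonneg hA0 ha0.le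
  -- admissible `S` on `[L, ∞)` ⇒ tail estimate
  have htail : ∀ L : ℝ, 1 ≤ L → ∀ S : ℝ, 0 ≤ S → S ≤ 3 * c → (∀ R, L ≤ R → N R ≤ S) →
      ∀ L₁ L₂ : ℝ, L ≤ L₁ → L₁ ≤ L₂ → |N L₂ - N L₁| ≤ B₀ * S ^ (1 / 2 : ℝ) * L₁ ^ (-a) := by
    intro L hL S hS hS3 hSsup L₁ L₂ hL₁ h12
    have hL0 : 0 < L := lt_of_lt_of_le one_pos hL
    have hsup' : ∀ R : ℝ, L ≤ R → ∫ y, σ (R⁻¹ • y) * ‖V y‖ ^ 2 ≤ R ^ (1 - 2 * ρ) * S := by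
      intro R hR
      have hR0 : 0 < R := lt_of_lt_of_le hL0 hR
      have h := hSsup R hR
      have hRR : R ^ (1 - 2 * ρ) * R ^ (2 * ρ - 1) = 1 := by rw [← Real.rpow_add hR0]; norm_num
      calc ∫ y, σ (R⁻¹ • y) * ‖V y‖ ^ 2 = R ^ (1 - 2 * ρ) * N R := by
            simp only [hN]; rw [← mul_assoc, hRR, one_mul]
        _ ≤ R ^ (1 - 2 * ρ) * S := mul_le_mul_of_nonneg_left h (Real.rpow_nonneg hR0.le _)
    have hfl := hflux S hS hS3 L hL hsup'
    have hfl' : ∀ r : ℝ, L ≤ r → |(2 + ρ) * r ^ (2 * ρ - 2) *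
        ∫ x, (‖V x‖ ^ 2 + 2 * P x) * ⟪V x, gradient (fun z => σ (r⁻¹ • z)) x⟫| ≤
        (A * S ^ (1 / 2 : ℝ)) * r ^ (-1 - a) := fun r hr => by rw [hadef]; exact hfl r hr
    have hAS : 0 ≤ A * S ^ (1 / 2 : ℝ) := by positivity
    have h := abs_normEnergy_sub_le_of_fluxWeight_le hρ hσ hVm hV2 hEEσ hAS ha0 hL0 hfl' hL₁ h12
    simp only [hN]
    calc |L₂ ^ (2 * ρ - 1) * (∫ y, σ (L₂⁻¹ • y) * ‖V y‖ ^ 2) -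
          L₁ ^ (2 * ρ - 1) * (∫ y, σ (L₁⁻¹ • y) * ‖V y‖ ^ 2)| ≤ A * S ^ (1 / 2 : ℝ) / a * L₁ ^ (-a) := h
      _ = B₀ * S ^ (1 / 2 : ℝ) * L₁ ^ (-a) := by rw [hB₀]; ring
  -- smallness at arbitrarily large scales: `N(L'/2) < 2ε`
  have hsmall : ∀ ε : ℝ, 0 < ε → ∀ R₀ : ℝ, 0 < R₀ → ∃ R' : ℝ, R₀ ≤ R' ∧ N R' < 2 * ε := by
    intro ε hε R₀ hR₀
    obtain ⟨L', hL', hlt⟩ := hsub ε hε (2 * R₀)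
    have hL'0 : 0 < L' := by linarith
    refine ⟨L' / 2, by linarith, ?_⟩
    have hB : IntegrableOn (fun y => ‖V y‖ ^ 2) (ball (0 : EuclideanSpace ℝ (Fin 3)) L') volume :=
      (memLp_two_iff_integrable_sq_norm hVm.restrict).1 (memLp_two_ball_of_growth_loc hVm hA _)
    -- `∫ σ(2y/L') |V|² ≤ ∫_{B_{L'}} |V|²`
    have hle : ∫ y, σ ((L' / 2)⁻¹ • y) * ‖V y‖ ^ 2 ≤ ∫ y in ball (0 : EuclideanSpace ℝ (Fin 3)) L', ‖V y‖ ^ 2 := by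
      rw [← integral_indicator measurableSet_ball]
      refine integral_mono_of_nonneg (Eventually.of_forall fun y => mul_nonneg (h0 _) (sq_nonneg _))
        (hB.integrable_indicator measurableSet_ball) (Eventually.of_forall fun y => ?_)
      by_cases hy : y ∈ ball (0 : EuclideanSpace ℝ (Fin 3)) L'
      · rw [indicator_of_mem hy]
        exact mul_le_of_le_one_left (sq_nonneg _) (h1 _)
      · rw [indicator_of_notMem hy]
        rw [mem_ball, dist_zero_right, not_lt] at hy
        have : σ ((L' / 2)⁻¹ • y) = 0 := by
          apply hzero
          rw [norm_smul, norm_inv, Real.norm_of_nonneg (by positivity), le_inv_mul_iff₀ (by positivity)]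
          linarith
        show σ ((L' / 2)⁻¹ • y) * ‖V y‖ ^ 2 ≤ 0
        rw [this, zero_mul]
    have hI0 : 0 ≤ ∫ y in ball (0 : EuclideanSpace ℝ (Fin 3)) L', ‖V y‖ ^ 2 :=
      setIntegral_nonneg measurableSet_ball fun y _ => sq_nonneg _
    have hpow : (L' / 2) ^ (2 * ρ - 1) ≤ 2 * L' ^ (2 * ρ - 1) := by
      rw [Real.div_rpow hL'0.le (by norm_num)]
      rw [div_le_iff₀ (Real.rpow_pos_of_pos two_pos _)]
      have h2 : (2 : ℝ) ^ (2 * ρ - 1) ≥ 2⁻¹ := by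
        rw [show (2 : ℝ)⁻¹ = 2 ^ (-1 : ℝ) by rw [Real.rpow_neg_one]]
        exact Real.rpow_le_rpow_of_exponent_le (by norm_num) (by linarith)
      nlinarith [Real.rpow_nonneg hL'0.le (2 * ρ - 1), h2]
    simp only [hN]
    calc (L' / 2) ^ (2 * ρ - 1) * ∫ y, σ ((L' / 2)⁻¹ • y) * ‖V y‖ ^ 2
        ≤ (2 * L' ^ (2 * ρ - 1)) * ∫ y in ball (0 : EuclideanSpace ℝ (Fin 3)) L', ‖V y‖ ^ 2 :=
          mul_le_mul hpow hle (integral_nonneg fun y => mul_nonneg (h0 _) (sq_nonneg _)) (by positivity)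
      _ = 2 * (L' ^ (2 * ρ - 1) * ∫ y in ball (0 : EuclideanSpace ℝ (Fin 3)) L', ‖V y‖ ^ 2) := by ring
      _ < 2 * ε := by linarith
  -- KEY CLAIM: an admissible `S` on `[L, ∞)` improves to `B₀ S^{1/2} L^{-a}`
  have hkey : ∀ L : ℝ, 1 ≤ L → ∀ S : ℝ, 0 ≤ S → S ≤ 3 * c → (∀ R, L ≤ R → N R ≤ S) →
      ∀ R, L ≤ R → N R ≤ B₀ * S ^ (1 / 2 : ℝ) * L ^ (-a) := by
    intro L hL S hS hS3 hSsup R hR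
    have hL0 : 0 < L := lt_of_lt_of_le one_pos hL
    have hR0 : 0 < R := lt_of_lt_of_le hL0 hR
    have hRa : R ^ (-a) ≤ L ^ (-a) := Real.rpow_le_rpow_of_nonpos hL0 hR (by linarith)
    refine le_of_forall_pos_lt_add fun ε hε => ?_
    obtain ⟨R', hRR', hsmallR'⟩ := hsmall (ε / 2) (by positivity) R hR0
    have ht := htail L hL S hS hS3 hSsup R R' hR hRR'
    have : N R ≤ N R' + B₀ * S ^ (1 / 2 : ℝ) * R ^ (-a) := by
      have := abs_sub_le_iff.1 ht
      linarith [this.2]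
    have hmono : B₀ * S ^ (1 / 2 : ℝ) * R ^ (-a) ≤ B₀ * S ^ (1 / 2 : ℝ) * L ^ (-a) :=
      mul_le_mul_of_nonneg_left hRa (by positivity)
    linarith
  -- ABSORPTION: the tail supremum on `[L, ∞)` is at most `B₀² L^{-2a}`
  have hdecay : ∀ L : ℝ, 1 ≤ L → N L ≤ B₀ ^ 2 * (L ^ (-a)) ^ 2 := by
    intro L hL
    have hL0 : 0 < L := lt_of_lt_of_le one_pos hL
    set T : Set ℝ := N '' Ici L with hT
    have hTne : T.Nonempty := ⟨N L, L, Set.self_mem_Ici, rfl⟩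
    have hTbdd : BddAbove T := ⟨3 * c, by
      rintro _ ⟨R, hR, rfl⟩; exact hN3 R (hL.trans (Set.mem_Ici.1 hR))⟩
    set S : ℝ := sSup T with hSdef
    have hSsup : ∀ R, L ≤ R → N R ≤ S := fun R hR => le_csSup hTbdd ⟨R, Set.mem_Ici.2 hR, rfl⟩
    have hS0 : 0 ≤ S := (hN0 L hL0).trans (hSsup L le_rfl)
    have hS3 : S ≤ 3 * c := csSup_le hTne (by
      rintro _ ⟨R, hR, rfl⟩; exact hN3 R (hL.trans (Set.mem_Ici.1 hR)))
    have hSle : S ≤ B₀ * S ^ (1 / 2 : ℝ) * L ^ (-a) :=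
      csSup_le hTne (by rintro _ ⟨R, hR, rfl⟩; exact hkey L hL S hS0 hS3 hSsup R (Set.mem_Ici.1 hR))
    have habs := le_sq_of_le_mul_sqrt hS0 hB₀0 (Real.rpow_nonneg hL0.le _) hSle
    exact (hSsup L le_rfl).trans habs
  -- CONCLUSION: the energy of every ball vanishes
  have hballzero : ∀ L₀ : ℝ, 0 < L₀ → ∫⁻ y in ball (0 : EuclideanSpace ℝ (Fin 3)) L₀, ‖V y‖ₑ ^ 2 = 0 := by
    intro L₀ hL₀
    refine le_antisymm (ENNReal.le_of_forall_pos_le_add fun δ hδ _ => ?_) zero_le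
    rw [zero_add]
    -- choose `L ≥ max L₀ 1` with `B₀² L^{1-2ρ-2a} < δ`
    have hexp : (1 - 2 * ρ) + -(2 * a) < 0 := by rw [hadef]; linarith
    have htend : Tendsto (fun L : ℝ => B₀ ^ 2 * L ^ ((1 - 2 * ρ) + -(2 * a))) atTop (𝓝 (B₀ ^ 2 * 0)) := by
      refine tendsto_const_nhds.mul ?_
      have := tendsto_rpow_neg_atTop (y := -((1 - 2 * ρ) + -(2 * a))) (by linarith)
      simpa using this
    rw [mul_zero] at htend
    have hev := (htend.eventually (gt_mem_nhds (show (0 : ℝ) < δ from hδ))).and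
      (eventually_ge_atTop (max L₀ 1))
    obtain ⟨L, hLδ, hLge⟩ := hev.exists
    have hL1 : 1 ≤ L := (le_max_right _ _).trans hLge
    have hL0 : 0 < L := lt_of_lt_of_le one_pos hL1
    have hLL₀ : L₀ ≤ L := (le_max_left _ _).trans hLge
    -- `∫_{B_{L₀}} ≤ ∫_{B_L} ≤ ofReal (∫ σ_L |V|²) ≤ ofReal (L^{1-2ρ} B₀² L^{-2a})`
    have h1 := lintegral_ball_sq_le_cutoffEnergy hσs.continuous hσc h0 hone hV2 hL0
    have hNL := hdecay L hL1
    have hI : ∫ y, σ (L⁻¹ • y) * ‖V y‖ ^ 2 ≤ B₀ ^ 2 * L ^ ((1 - 2 * ρ) + -(2 * a)) := by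
      have hRR : L ^ (1 - 2 * ρ) * L ^ (2 * ρ - 1) = 1 := by rw [← Real.rpow_add hL0]; norm_num
      have e2 : (L ^ (-a)) ^ 2 = L ^ (-(2 * a)) := by
        rw [← Real.rpow_natCast, ← Real.rpow_mul hL0.le]; norm_num; ring_nf
      calc ∫ y, σ (L⁻¹ • y) * ‖V y‖ ^ 2 = L ^ (1 - 2 * ρ) * N L := by
            simp only [hN]; rw [← mul_assoc, hRR, one_mul]
        _ ≤ L ^ (1 - 2 * ρ) * (B₀ ^ 2 * (L ^ (-a)) ^ 2) :=
            mul_le_mul_of_nonneg_left hNL (Real.rpow_nonneg hL0.le _)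
        _ = B₀ ^ 2 * (L ^ (1 - 2 * ρ) * L ^ (-(2 * a))) := by rw [e2]; ring
        _ = B₀ ^ 2 * L ^ ((1 - 2 * ρ) + -(2 * a)) := by rw [← Real.rpow_add hL0]
    calc ∫⁻ y in ball (0 : EuclideanSpace ℝ (Fin 3)) L₀, ‖V y‖ₑ ^ 2
        ≤ ∫⁻ y in ball (0 : EuclideanSpace ℝ (Fin 3)) L, ‖V y‖ₑ ^ 2 := lintegral_mono_set (ball_subset_ball hLL₀)
      _ ≤ ENNReal.ofReal (∫ y, σ (L⁻¹ • y) * ‖V y‖ ^ 2) := h1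
      _ ≤ ENNReal.ofReal (B₀ ^ 2 * L ^ ((1 - 2 * ρ) + -(2 * a))) := ENNReal.ofReal_le_ofReal hI
      _ ≤ (δ : ℝ≥0∞) := by
          rw [← ENNReal.ofReal_coe_nnreal]; exact ENNReal.ofReal_le_ofReal hLδ.le
  -- hence `V = 0` a.e.
  have hball_ae : ∀ n : ℕ, ∀ᵐ y ∂(volume.restrict (ball (0 : EuclideanSpace ℝ (Fin 3)) ((n : ℝ) + 1))), V y = 0 := by
    intro n
    have h := hballzero ((n : ℝ) + 1) (by positivity)
    rw [lintegral_eq_zero_iff' (hVm.restrict.enorm.pow_const 2)] at h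
    filter_upwards [h] with y hy
    simpa using hy
  have hunion : (⋃ n : ℕ, ball (0 : EuclideanSpace ℝ (Fin 3)) ((n : ℝ) + 1)) = univ := by
    refine eq_univ_of_forall fun y => mem_iUnion.2 ?_
    obtain ⟨n, hn⟩ := exists_nat_gt ‖y‖
    exact ⟨n, by rw [mem_ball, dist_zero_right]; linarith⟩
  have h := (ae_restrict_iUnion_iff (μ := (volume : Measure (EuclideanSpace ℝ (Fin 3))))
    (fun n : ℕ => ball (0 : EuclideanSpace ℝ (Fin 3)) ((n : ℝ) + 1)) (fun y => V y = 0)).2 hball_ae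
  rw [hunion, Measure.restrict_univ] at h
  exact h

/-- **A spiral member whose velocity profile vanishes a.e. is trivial** (crux hypotheses verbatim, any `ρ ≥ 0`): for every
`τ < T₁` the slice `u(τ) = (T−τ)^{γ−1} e^{sS} V(e^{−sS}(T−τ)^{−γ}(· − x₀))` vanishes a.e. — translated dilations are
quasi-measure-preserving (`Past.quasiMeasurePreserving_smul_sub`) and rotations `e^{−sS}` (`S` skew) preserve Lebesgue measure
(`Killing.measurePreserving_expSkew`) — so the past is energy-quiescent and the crux's filled stratum
`ae_eq_zero_of_gauge_of_energyVanishing_allRho` applies.  The spiral twin of `Past.ae_eq_zero_of_profile_ae_eq_zero`. [folklore] -/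
theorem spiral_ae_eq_zero_of_profile_ae_eq_zero {ρ T T₁ : ℝ} {x₀ : E3} {S : E3 →L[ℝ] E3}
    {u : ℝ → E3 → E3} {p : ℝ → E3 → ℝ} {H : ℝ → E3 → E3 →L[ℝ] E3} {c : ℝ≥0} {V : E3 → E3}
    (hρ : 0 ≤ ρ) (hTT₁ : T₁ ≤ T)
    (hsw : IsSuitableWeakSolutionOn (slab (EuclideanSpace ℝ (Fin 3)) (Set.Iio 0) isOpen_Iio) 0 0 u p)
    (hH : HasWeakSpatialGradientOn (slab (EuclideanSpace ℝ (Fin 3)) (Set.Iio 0) isOpen_Iio) u H)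
    (hgauge : ∀ a : ℝ, 0 < a →
      ENNReal.ofReal (a ^ (2 * ρ)) * cknA a (0 : ℝ × E3) u + ENNReal.ofReal (a ^ ρ) * cknE a (0 : ℝ × E3) H +
        ENNReal.ofReal (a ^ (2 * ρ)) * cknD a (0 : ℝ × E3) p ≤ (c : ℝ≥0∞))
    (hS : IsSkew S) (hu : IsPastSpiral ρ T T₁ x₀ S u V) (hV0 : V =ᵐ[volume] 0) : VanishesAE u := by
  have hSx : ∀ x : E3, ⟪S x, x⟫ = 0 := by
    intro x
    have h := hS x x
    have h' : ⟪S x, x⟫ = ⟪x, S x⟫ := real_inner_comm _ _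
    linarith
  refine ae_eq_zero_of_gauge_of_energyVanishing_allRho hρ hsw hH hgauge fun ε hε N => ?_
  -- the energy vanishes identically for `s < min (−N) T₁`
  have hsub : Set.Iio (min (-N) T₁) ⊆ {s : ℝ | s < -N ∧ ∫⁻ x, ‖u s x‖ₑ ^ 2 ≤ ENNReal.ofReal ε} := by
    intro s hs
    rw [Set.mem_Iio, lt_min_iff] at hs
    refine ⟨hs.1, ?_⟩
    have hsT : 0 < T - s := by linarith [hs.2]
    have hd : (T - s) ^ (-(1 / (2 + ρ))) ≠ 0 := (Real.rpow_pos_of_pos hsT _).ne'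
    have hqmp : Measure.QuasiMeasurePreserving
        ((fun x : E3 => NormedSpace.exp ((-Real.log (T - s)) • S) x) ∘ fun x : E3 => (T - s) ^ (-(1 / (2 + ρ))) • (x - x₀))
        volume volume :=
      (Killing.measurePreserving_expSkew hSx (-Real.log (T - s))).quasiMeasurePreserving.comp
        (Past.quasiMeasurePreserving_smul_sub hd x₀)
    have hae : (fun x => ‖u s x‖ₑ ^ 2) =ᵐ[volume] fun _ => 0 := by
      have h1 := hqmp.ae_eq_comp hV0
      filter_upwards [h1] with x hx
      simp only [comp_apply, Pi.zero_apply] at hx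
      rw [hu s hs.2]
      simp only [twist]
      rw [hx, map_zero, smul_zero, enorm_zero, zero_pow two_ne_zero]
    rw [lintegral_congr_ae hae, lintegral_zero]
    exact zero_le
  have hinf : volume (Set.Iio (min (-N) T₁)) = (⊤ : ℝ≥0∞) := Real.volume_Iio
  intro h0
  have := measure_mono_null hsub h0
  rw [hinf] at this
  exact ENNReal.top_ne_zero this

/-- **R3 from R3a (kernel-checked composition, rev4)**: the spiral dictionary, the RADIAL energy-saturation endgame
(`ae_eq_zero_of_subExtremal_loc_radial`, proved) and the null-set transport (`spiral_ae_eq_zero_of_profile_ae_eq_zero`, proved) give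
the sub-extremal spiral kill.  Pattern: `Past.selfSimilar_ae_eq_zero_of_subExtremal_past`. -/
theorem spiralSubExtremal_of_locData (h3a : Sig.stub_spiralLocData) : Sig.stub_spiralSubExtremal := by
  intro ρ hρ hρh u p H c T T₁ x₀ S V hIn hT₁ hTT₁ hS hsp hsub
  have hρ1 : ρ < 1 := by linarith
  obtain ⟨P, G, c', hVm, hPm, hGm, hVG, hA₁, hE₁, hD₁, hPoisson, hEE⟩ :=
    h3a ρ hρ hρh u p H c T T₁ x₀ S V hIn hT₁ hTT₁ hS hsp
  have hV0 : V =ᵐ[volume] 0 :=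
    ae_eq_zero_of_subExtremal_loc_radial hρ hρ1 hVm hPm hGm hVG hA₁ hE₁ hD₁ hPoisson hEE hsub
  exact spiral_ae_eq_zero_of_profile_ae_eq_zero hρ.le hTT₁ hIn.1 hIn.2.1 hIn.2.2 hS hsp hV0

end SpiralEndgame

/-! ## Stubs -/

/-- STUB R1 [OPEN, S/M — twisted clocks: relative equilibria / relative periodic orbits]. -/
theorem stub_twistedClock : Sig.stub_twistedClock :=
  -- R1 LANDED BY NAME (rev3): ns-ezl-w6 g2, p650280 ACCEPTED `Theorems/…PastTwisted.lean` (bodies verbatim; equation-free, by slices;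
  -- the binder `ρ ≤ 1/2` is idle — every `ρ > 0` works).
  Summit.NavierStokesRegularity.NavierStokesRegularity.Theorems.PowerGaugeEulerLiouville.Twisted.twistedClock_stratum

/-- STUB R2 [OPEN, M — tame `C²` spiral profiles (uniformly continuous or irrotational piercing)]. -/
theorem stub_spiralTame : Sig.stub_spiralTame := by
  sorry

/-- R3a [PROVED FROM THE TREE (REV8) — the spiral dictionary `Sig.stub_spiralLocData`: large-scale profile data of a spiral member.
The Theorems-side assembly `Spiral.exists_locData_of_pastSpiral` (`Theorems/…SpiralLocData.lean`, ns-ezl-w1 g10 p727126; bricks P2T p724319,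
P3 p723738/p723856 + P3b, P4 ns-sfl-p1 g11 p724153/p725919 (pressure slaving), P5 p724138, P6 ns-ezl-w2 g8 p724667…p726043, P7 ns-ezl-w3 g9
p725186…p726382, unify p724574) states exactly the nine clauses below over the SAME `@[reducible]` binder predicates (`InClass`, `IsSkew`,
`IsPastSpiral` = the `twist`/`NormedSpace.exp` ansatz, `HasRadialGradient`), so the port is `exact` BY NAME.  The in-file bricks of REV5/REV6
(`spiral_energy_growth_of_gaugeA_past`, `spiral_profileGradient_ae_of_past`, …) remain as this line's own P2/P3 chain. -/
theorem stub_spiralLocData : Sig.stub_spiralLocData := by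
  intro ρ hρ hρh u p H c T T₁ x₀ S V hcl hT₁ hTT₁ hS hu
  exact Theorems.PowerGaugeEulerLiouville.Spiral.exists_locData_of_pastSpiral hρ hρh hcl hT₁ hTT₁ hS hu

/-- R3 [PROVED (rev4 from R3a; SORRY-FREE since REV8) — sub-extremal spiral profiles, any regularity: radial energy-saturation endgame
`ae_eq_zero_of_subExtremal_loc_radial` + null-set transport `spiral_ae_eq_zero_of_profile_ae_eq_zero`, composed in
`spiralSubExtremal_of_locData`; R3a is now the tree theorem `Spiral.exists_locData_of_pastSpiral`.  (The same statement, as the v118 binder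
`¬ IsPastSpiralSubExtremal ρ u`, is ALSO the tree theorem `Spiral.pastSpiralSubExtremal_trivial`, LEAD g17 p727289 — see
`Sig.stub_spiralSubExtremal_iff_member`.) -/
theorem stub_spiralSubExtremal : Sig.stub_spiralSubExtremal :=
  spiralSubExtremal_of_locData stub_spiralLocData

/-- R4a [FILLED BY NAME (REV9) — `Spiral.pastSpiralTameWeak_trivial`, ns-ezl-w3 g9 p728352 = birth v119 binder #41]. -/
theorem stub_spiralTameWeak : Sig.stub_spiralTameWeak :=
  fun _ρ hρ hρh _u _p _H _c hcl hw =>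
    Theorems.PowerGaugeEulerLiouville.Spiral.pastSpiralTameWeak_trivial hρ hρh hcl hw

/-- STUB R4b [OPEN residue, not claimed — spiral needles / rough super-extremal spiral profiles outside the four weak senses]. -/
theorem stub_spiralRestB : Sig.stub_spiralRestB := by
  sorry

/-- R4 [PROVED from R4a (by name) + R4b (REV9 seam `spiralRest_of_split`); the open content is R4b]. -/
theorem stub_spiralRest : Sig.stub_spiralRest :=
  spiralRest_of_split stub_spiralTameWeak stub_spiralRestB

/-- STUB R5 [OPEN residue, not claimed — non-relative members]. -/
theorem stub_nonRelativeRest : Sig.stub_nonRelativeRest := by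
  sorry

/-! ## Composition (kernel-checked): the five stubs imply the crux BY NAME -/

/-- `ρ > 1/2`: the landed `powerGaugeEulerLiouville_largeRho`; `0 < ρ ≤ 1/2`: a twisted clock dies by R1; a spiral member dies by
R2 (tame `C²` profile), R3 (sub-extremal profile) or goes to the spiral residue R4; everything else is the residue R5. -/
theorem PowerGaugeEulerLiouville_of :
    Sig.stub_twistedClock → Sig.stub_spiralTame → Sig.stub_spiralSubExtremal → Sig.stub_spiralRest →
      Sig.stub_nonRelativeRest →
      Summit.NavierStokesRegularity.NavierStokesRegularity.Theses.EulerZoomLiouville.PowerGaugeEulerLiouville := by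
  intro h1 h2 h3 h4 h5 ρ hρ u p H c hsw hH hc
  by_cases hhalf : 1 / 2 < ρ
  · exact
      Summit.NavierStokesRegularity.NavierStokesRegularity.Theorems.PowerGaugeEulerLiouville.powerGaugeEulerLiouville_largeRho
        ρ hhalf u p H c hsw hH hc
  · have hρ2 : ρ ≤ 1 / 2 := not_lt.mp hhalf
    have hIn : InClass ρ u p H c := ⟨hsw, hH, hc⟩
    by_cases hTw : IsPastTwistedSteady u ∨ IsPastTwistedPeriodic u
    · exact h1 ρ hρ hρ2 u p H c hIn hTw
    · have hTs : ¬ IsPastTwistedSteady u := fun h => hTw (Or.inl h)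
      have hTp : ¬ IsPastTwistedPeriodic u := fun h => hTw (Or.inr h)
      by_cases hSp : IsPastSpiralMember ρ u
      · obtain ⟨T, T₁, x₀, S, V, hT₁, hT₁T, hS, hsp⟩ := hSp
        by_cases hTame : IsSpiralTameProfile ρ V
        · exact h2 ρ hρ hρ2 u p H c T T₁ x₀ S V hIn hT₁ hT₁T hS hsp hTame
        · by_cases hSub : IsSubExtremalProfile ρ V
          · exact h3 ρ hρ hρ2 u p H c T T₁ x₀ S V hIn hT₁ hT₁T hS hsp hSub
          · exact h4 ρ hρ hρ2 u p H c T T₁ x₀ S V hIn hT₁ hT₁T hS hsp hTame hSub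
      · exact h5 ρ hρ hρ2 u p H c hIn hTs hTp hSp

/-! ## Dictionary and sanity lemmas (kernel-checked; not stubs, not used by the composition) -/

/-- `⟪S y, y⟫ = 0` for a skew generator: the radial component of the spiral wind `V + γy + Sy` is that of the untwisted wind, so the
fast-inflow (Fermat exit) condition of the piercing argument is free of `S` (lever L2). -/
theorem inner_skew_self {S : E3 →L[ℝ] E3} (hS : IsSkew S) (y : E3) : ⟪S y, y⟫ = 0 := by
  have h := hS y y
  have h' : ⟪S y, y⟫ = ⟪y, S y⟫ := real_inner_comm _ _
  linarith

/-- The rotation clock at logarithmic time `0` is the identity. -/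
theorem twist_zero (S : E3 →L[ℝ] E3) : twist S 0 = 1 := by
  have h0 : (0 : ℝ) • S = 0 := zero_smul ℝ S
  rw [twist, h0]
  exact NormedSpace.exp_zero

/-- With the trivial generator the clock never turns. -/
theorem twist_of_generator_zero (s : ℝ) : twist (0 : E3 →L[ℝ] E3) s = 1 := by
  have h0 : s • (0 : E3 →L[ℝ] E3) = 0 := by ext x; simp
  rw [twist, h0]
  exact NormedSpace.exp_zero

/-- DICTIONARY: a spiral member with generator `S = 0` is exactly a past-exactly-self-similar member in the LEAD's sense,
`u(τ) = selfSimilarCollapse γ T V τ (· − x₀)` for `τ < T₁` (the `hu`-binder of `IsPastSelfSimilar ρ T T₁ x₀ u V`). -/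
theorem isPastSpiral_zero_iff (ρ T T₁ : ℝ) (x₀ : E3) (u : ℝ → E3 → E3) (V : E3 → E3) :
    IsPastSpiral ρ T T₁ x₀ 0 u V ↔
      ∀ τ : ℝ, τ < T₁ → u τ = fun x => selfSimilarCollapse (1 / (2 + ρ)) T V τ (x - x₀) := by
  simp only [IsPastSpiral, twist_of_generator_zero, one_apply_eq_self, selfSimilarCollapse_apply]

section SpiralLocDataZero

open Function TopologicalSpace
open scoped ContDiff Laplacian InnerProductSpace
open Literature.Analysis.FunctionSpaces
open Summit.NavierStokesRegularity.NavierStokesRegularity.Theorems.PowerGaugeEulerLiouville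

/-- **R3a AT `S = 0` IS A TREE THEOREM (rev4 sanity, kernel-checked; the cheapest falsifier of the dictionary's TYPING).**  For the
untwisted generator the spiral dictionary `Sig.stub_spiralLocData` is literally pressure slaving (`PressureSlaving.inClass_pastSelfSimilarPressure`,
p635404) followed by the past profile data `Past.exists_locData_of_past` (p607109), with the local energy identity a fortiori for radial-gradient
tests.  So the exponents / normalisations / threshold shapes of R3a are exactly the tree's. -/
theorem spiralLocData_zero {ρ : ℝ} (hρ : 0 < ρ) (hρh : ρ ≤ 1 / 2)
    {u : ℝ → E3 → E3} {p : ℝ → E3 → ℝ} {H : ℝ → E3 → E3 →L[ℝ] E3} {c : ℝ≥0} {T T₁ : ℝ} {x₀ : E3} {V : E3 → E3}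
    (hIn : InClass ρ u p H c) (hT₁ : T₁ ≤ 0) (hTT₁ : T₁ ≤ T) (hsp : IsPastSpiral ρ T T₁ x₀ 0 u V) :
    ∃ (P : E3 → ℝ) (G : E3 → E3 →L[ℝ] E3) (c' : ℝ≥0),
      AEStronglyMeasurable V volume ∧ AEStronglyMeasurable P volume ∧ AEStronglyMeasurable G volume ∧
      HasWeakFDerivOn (⊤ : TopologicalSpace.Opens E3) volume V G ∧
      (∀ L : ℝ, 1 ≤ L → ∫⁻ y in Metric.ball (0 : E3) L, ‖V y‖ₑ ^ 2 ≤
        (c' : ℝ≥0∞) * ENNReal.ofReal (L ^ (1 - 2 * ρ))) ∧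
      (∀ L : ℝ, 1 ≤ L →
        ∫⁻ y in Metric.ball (0 : E3) L, ENNReal.ofReal (frobeniusNormSq (G y)) ≤
          ENNReal.ofReal (L ^ (1 - ρ)) * (ENNReal.ofReal ((1 - ρ) / (2 + ρ)) * (c' : ℝ≥0∞))) ∧
      (∀ L : ℝ, 1 ≤ L →
        ∫⁻ y in Metric.ball (0 : E3) L, ‖P y‖ₑ ^ (3 / 2 : ℝ) ≤
          ENNReal.ofReal (L ^ (2 - 2 * ρ)) * (ENNReal.ofReal ((2 - 2 * ρ) / (2 + ρ)) * (c' : ℝ≥0∞))) ∧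
      (∀ θ : E3 → ℝ, ContDiff ℝ (⊤ : ℕ∞) θ → HasCompactSupport θ →
        ∫ y, P y * (Δ θ) y = -∫ y, fderiv ℝ (fderiv ℝ θ) y (V y) (V y)) ∧
      (∀ θ : E3 → ℝ, IsTestFunctionOn (⊤ : TopologicalSpace.Opens E3) θ → HasRadialGradient θ →
        (2 - 5 * (1 / (2 + ρ))) * ∫ x, θ x * ‖V x‖ ^ 2 =
          (∫ x, (‖V x‖ ^ 2 + 2 * P x) * ⟪V x, gradient θ x⟫) +
            (1 / (2 + ρ)) * ∫ x, ‖V x‖ ^ 2 * ⟪x, gradient θ x⟫) := by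
  have hu := (isPastSpiral_zero_iff ρ T T₁ x₀ u V).1 hsp
  obtain ⟨Q, p', -, hp', -, h'⟩ :=
    PressureSlaving.inClass_pastSelfSimilarPressure (g := 1 / (2 + ρ)) (by linarith) hT₁ hTT₁ hIn hu
  obtain ⟨G, c', hVm, hPm, hGm, hVG, hA₁, hE₁, hD₁, hPoisson, hEE⟩ :=
    Past.exists_locData_of_past hρ hρh hT₁ hTT₁ x₀ h'.1 h'.2.1 h'.2.2 hu hp'
  exact ⟨Q, G, c', hVm, hPm, hGm, hVG, hA₁, hE₁, hD₁, hPoisson, fun θ hθ _ => hEE θ hθ⟩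

/-- The `S = 0` CASE of R3a as a statement (the stub's binders with the generator frozen to `0`). -/
def SpiralLocDataZeroCase : Prop :=
  ∀ ρ : ℝ, 0 < ρ → ρ ≤ 1 / 2 → ∀ (u : ℝ → E3 → E3) (p : ℝ → E3 → ℝ) (H : ℝ → E3 → E3 →L[ℝ] E3) (c : ℝ≥0)
    (T T₁ : ℝ) (x₀ : E3) (V : E3 → E3),
    InClass ρ u p H c → T₁ ≤ 0 → T₁ ≤ T → IsPastSpiral ρ T T₁ x₀ 0 u V →
      ∃ (P : E3 → ℝ) (G : E3 → E3 →L[ℝ] E3) (c' : ℝ≥0),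
        AEStronglyMeasurable V volume ∧ AEStronglyMeasurable P volume ∧ AEStronglyMeasurable G volume ∧
        HasWeakFDerivOn (⊤ : TopologicalSpace.Opens E3) volume V G ∧
        (∀ L : ℝ, 1 ≤ L → ∫⁻ y in Metric.ball (0 : E3) L, ‖V y‖ₑ ^ 2 ≤
          (c' : ℝ≥0∞) * ENNReal.ofReal (L ^ (1 - 2 * ρ))) ∧
        (∀ L : ℝ, 1 ≤ L →
          ∫⁻ y in Metric.ball (0 : E3) L, ENNReal.ofReal (frobeniusNormSq (G y)) ≤
            ENNReal.ofReal (L ^ (1 - ρ)) * (ENNReal.ofReal ((1 - ρ) / (2 + ρ)) * (c' : ℝ≥0∞))) ∧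
        (∀ L : ℝ, 1 ≤ L →
          ∫⁻ y in Metric.ball (0 : E3) L, ‖P y‖ₑ ^ (3 / 2 : ℝ) ≤
            ENNReal.ofReal (L ^ (2 - 2 * ρ)) * (ENNReal.ofReal ((2 - 2 * ρ) / (2 + ρ)) * (c' : ℝ≥0∞))) ∧
        (∀ θ : E3 → ℝ, ContDiff ℝ (⊤ : ℕ∞) θ → HasCompactSupport θ →
          ∫ y, P y * (Δ θ) y = -∫ y, fderiv ℝ (fderiv ℝ θ) y (V y) (V y)) ∧
        (∀ θ : E3 → ℝ, IsTestFunctionOn (⊤ : TopologicalSpace.Opens E3) θ → HasRadialGradient θ →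
          (2 - 5 * (1 / (2 + ρ))) * ∫ x, θ x * ‖V x‖ ^ 2 =
            (∫ x, (‖V x‖ ^ 2 + 2 * P x) * ⟪V x, gradient θ x⟫) +
              (1 / (2 + ρ)) * ∫ x, ‖V x‖ ^ 2 * ⟪x, gradient θ x⟫)

/-- The `S = 0` case of R3a is PROVED (tree theorems only). -/
theorem spiralLocDataZeroCase_holds : SpiralLocDataZeroCase :=
  fun _ hρ hρh _ _ _ _ _ _ _ _ hIn hT₁ hTT₁ hsp => spiralLocData_zero hρ hρh hIn hT₁ hTT₁ hsp

/-- …and it is literally the `S = 0` specialisation of the stub (statement-shape check: `Sig.stub_spiralLocData` implies it, `IsSkew 0` being trivial). -/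
theorem spiralLocDataZeroCase_of_stub (h : Sig.stub_spiralLocData) : SpiralLocDataZeroCase :=
  fun ρ hρ hρh u p H c T T₁ x₀ V hIn hT₁ hTT₁ hsp =>
    h ρ hρ hρh u p H c T T₁ x₀ 0 V hIn hT₁ hTT₁ (fun x y => by simp) hsp

end SpiralLocDataZero

section SpiralGaugeA

open Summit.NavierStokesRegularity.NavierStokesRegularity.Theorems.PowerGaugeEulerLiouville

/-- Rotations by a skew generator preserve the norm: `‖e^{sS} v‖ = ‖v‖`. -/
theorem norm_twist_apply {S : E3 →L[ℝ] E3} (hS : IsSkew S) (s : ℝ) (v : E3) : ‖twist S s v‖ = ‖v‖ := by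
  have hSx : ∀ x : E3, ⟪S x, x⟫ = 0 := fun x => inner_skew_self hS x
  have h := Killing.inner_expSkew_expSkew hSx s v v
  rw [real_inner_self_eq_norm_sq, real_inner_self_eq_norm_sq] at h
  have h' : ‖NormedSpace.exp (s • S) v‖ = ‖v‖ := by
    have := abs_eq_abs.2 (Or.inl rfl : ‖v‖ = ‖v‖ ∨ ‖v‖ = -‖v‖)
    nlinarith [norm_nonneg (NormedSpace.exp (s • S) v), norm_nonneg v, sq_nonneg (‖NormedSpace.exp (s • S) v‖ - ‖v‖),
      sq_nonneg (‖NormedSpace.exp (s • S) v‖ + ‖v‖)]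
  simpa [twist] using h'

/-- **P2 OF THE R3a PORT RECIPE, PROVED: THE `A`-GAUGE OF A SPIRAL MEMBER IN PROFILE VARIABLES (large scales).**  The spiral version of
`Shifted.profile_energy_growth_of_gaugeA_past` (…SelfSimilarPastExtension), same threshold `L ≥ 2 − T₁` and the same constant: if
`u(τ, x) = λ^{γ−1} e^{(log λ)S} V(e^{−(log λ)S} λ^{−γ}(x − x₀))` for `τ < T₁` (`λ = T − τ`, `γ = 1/(2+ρ)`, `0 < ρ ≤ ½`, `T₁ ≤ 0`, `T₁ ≤ T`,
`S` skew) and `a^{2ρ} A(a; 0) ≤ c` for all `a > 0`, then `∫_{B_L} ‖V‖² ≤ C L^{1−2ρ}` for every `L ≥ 2 − T₁`, some `C < ∞`.  The proof is the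
untwisted one VERBATIM except for the change of variables `x = x₀ + σ e^{(log s)S} y` on the far-past slice: the rotation is absorbed by
`Killing.setLIntegral_ball_comp_expSkew` (origin-centred balls are rotation invariant) and `norm_twist_apply` — KEY ALGEBRA (i) of the recipe. -/
theorem spiral_energy_growth_of_gaugeA_past {ρ : ℝ} (hρ : 0 < ρ) (hρh : ρ ≤ 1 / 2) {T T₁ : ℝ} (hT₁ : T₁ ≤ 0) (hTT₁ : T₁ ≤ T)
    (x₀ : E3) {S : E3 →L[ℝ] E3} (hS : IsSkew S) {u : ℝ → E3 → E3} {V : E3 → E3} {c : ℝ≥0}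
    (hu : IsPastSpiral ρ T T₁ x₀ S u V)
    (hA : ∀ a : ℝ, 0 < a → ENNReal.ofReal (a ^ (2 * ρ)) * cknA a (0 : ℝ × E3) u ≤ (c : ℝ≥0∞)) :
    ∃ C : ℝ≥0∞, C ≠ ⊤ ∧ ∀ L : ℝ, 2 - T₁ ≤ L →
      ∫⁻ y in ball (0 : E3) L, ‖V y‖ₑ ^ 2 ≤ C * ENNReal.ofReal (L ^ (1 - 2 * ρ)) := by
  have hSx : ∀ x : E3, ⟪S x, x⟫ = 0 := fun x => inner_skew_self hS x
  set γ : ℝ := 1 / (2 + ρ) with hγ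
  -- the far-past slice `τ₁ = T₁ − 1` and `s = T − τ₁ ≥ 1`
  set τ₁ : ℝ := T₁ - 1 with hτ₁
  set s : ℝ := T - T₁ + 1 with hs
  have hs0 : 0 < s := by rw [hs]; linarith
  have hsτ : T - τ₁ = s := by rw [hτ₁, hs]; ring
  set σ : ℝ := s ^ γ with hσ
  have hσ0 : 0 < σ := Real.rpow_pos_of_pos hs0 _
  have h12ρ : 0 ≤ 1 - 2 * ρ := by linarith
  set k : ℝ := s ^ (2 - 2 * γ) * (σ ^ 3)⁻¹ * (σ + ‖x₀‖) ^ (1 - 2 * ρ) with hk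
  refine ⟨ENNReal.ofReal k * (c : ℝ≥0∞), ENNReal.mul_ne_top ENNReal.ofReal_ne_top ENNReal.coe_ne_top, fun L hL => ?_⟩
  have hL2 : 2 ≤ L := by linarith
  have hL0 : 0 < L := by linarith
  -- the radius `a`
  set a : ℝ := L * σ + ‖x₀‖ with ha
  have hσ1 : 1 ≤ σ := by
    rw [hσ]; exact Real.one_le_rpow (by rw [hs]; linarith) (by rw [hγ]; positivity)
  have haL : L ≤ a := by
    have : L * 1 ≤ L * σ := mul_le_mul_of_nonneg_left hσ1 hL0.le
    have := norm_nonneg x₀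
    rw [ha]; linarith
  have ha0 : 0 < a := by linarith
  have ha2 : 1 - T₁ < a ^ 2 := by nlinarith
  have hτ : τ₁ ∈ Ioo ((0 : ℝ × E3).1 - a ^ 2) (0 : ℝ × E3).1 := by
    simp only [Prod.fst_zero, zero_sub, mem_Ioo]
    constructor <;> [rw [hτ₁]; rw [hτ₁]] <;> linarith
  have hslice : (ENNReal.ofReal a)⁻¹ * ∫⁻ x in ball (0 : E3) a, ‖u τ₁ x‖ₑ ^ 2 ≤ cknA a (0 : ℝ × E3) u := by
    unfold cknA
    exact le_iSup₂ (f := fun t (_ : t ∈ Ioo ((0 : ℝ × E3).1 - a ^ 2) (0 : ℝ × E3).1) =>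
        (ENNReal.ofReal a)⁻¹ * ∫⁻ x in ball (0 : ℝ × E3).2 a, ‖u t x‖ₑ ^ 2) τ₁ hτ
  set I : ℝ≥0∞ := ∫⁻ x in ball (0 : E3) a, ‖u τ₁ x‖ₑ ^ 2 with hI
  have hgauge : ENNReal.ofReal (a ^ (2 * ρ)) * ((ENNReal.ofReal a)⁻¹ * I) ≤ (c : ℝ≥0∞) :=
    calc ENNReal.ofReal (a ^ (2 * ρ)) * ((ENNReal.ofReal a)⁻¹ * I)
        ≤ ENNReal.ofReal (a ^ (2 * ρ)) * cknA a (0 : ℝ × E3) u := by gcongr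
      _ ≤ (c : ℝ≥0∞) := hA a ha0
  have hKa : ENNReal.ofReal (a ^ (2 * ρ)) * (ENNReal.ofReal a)⁻¹ = ENNReal.ofReal (a ^ (2 * ρ - 1)) := by
    rw [← ENNReal.ofReal_inv_of_pos ha0, ← ENNReal.ofReal_mul (by positivity), Real.rpow_sub_one ha0.ne',
      div_eq_mul_inv]
  have hIle : I ≤ ENNReal.ofReal (a ^ (1 - 2 * ρ)) * (c : ℝ≥0∞) := by
    have hunit : ENNReal.ofReal (a ^ (1 - 2 * ρ)) * ENNReal.ofReal (a ^ (2 * ρ - 1)) = 1 := by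
      rw [← ENNReal.ofReal_mul (by positivity), ← Real.rpow_add ha0, show (1 - 2 * ρ) + (2 * ρ - 1) = 0 by ring,
        Real.rpow_zero, ENNReal.ofReal_one]
    calc I = ENNReal.ofReal (a ^ (1 - 2 * ρ)) * (ENNReal.ofReal (a ^ (2 * ρ - 1)) * I) := by
          rw [← mul_assoc, hunit, one_mul]
      _ = ENNReal.ofReal (a ^ (1 - 2 * ρ)) * (ENNReal.ofReal (a ^ (2 * ρ)) * ((ENNReal.ofReal a)⁻¹ * I)) := by
          rw [← mul_assoc (ENNReal.ofReal (a ^ (2 * ρ))), hKa]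
      _ ≤ ENNReal.ofReal (a ^ (1 - 2 * ρ)) * (c : ℝ≥0∞) := by gcongr
  -- ### change of variables `x = x₀ + σ e^{(log s) S} y` on the far-past slice (the ROTATED affine chart)
  have hval : ∀ y : E3,
      ‖u τ₁ (x₀ + σ • twist S (Real.log s) y)‖ₑ ^ 2 = ENNReal.ofReal (s ^ (2 * (γ - 1))) * ‖V y‖ₑ ^ 2 := by
    intro y
    rw [hu τ₁ (by rw [hτ₁]; linarith)]
    simp only [add_sub_cancel_left, smul_smul]
    rw [hsτ, hσ, ← Real.rpow_add hs0, show -γ + γ = 0 by ring, Real.rpow_zero, one_smul]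
    have hback : twist S (-Real.log s) (twist S (Real.log s) y) = y := by
      simp only [twist]
      exact Killing.expSkew_neg_apply_expSkew S (Real.log s) y
    rw [hback, enorm_smul, mul_pow, Real.enorm_eq_ofReal (Real.rpow_nonneg hs0.le _),
      ← ENNReal.ofReal_pow (Real.rpow_nonneg hs0.le _), ← Real.rpow_natCast (s ^ (γ - 1)) 2,
      ← Real.rpow_mul hs0.le, show (γ - 1) * ((2 : ℕ) : ℝ) = 2 * (γ - 1) by push_cast; ring]
    congr 1
    rw [← ofReal_norm, ← ofReal_norm, norm_twist_apply hS]
  have hpre : ball (0 : E3) L ⊆ (fun y : E3 => x₀ + σ • y) ⁻¹' ball (0 : E3) a := by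
    intro y hy
    rw [mem_ball_zero_iff] at hy
    rw [mem_preimage, mem_ball_zero_iff]
    calc ‖x₀ + σ • y‖ ≤ ‖x₀‖ + ‖σ • y‖ := norm_add_le _ _
      _ = ‖x₀‖ + σ * ‖y‖ := by rw [norm_smul, Real.norm_of_nonneg hσ0.le]
      _ < ‖x₀‖ + σ * L := by gcongr
      _ = a := by rw [ha]; ring
  have hcov := setLIntegral_preimage_comp_space_affine hσ0 x₀ (fun x : E3 => ‖u τ₁ x‖ₑ ^ 2) (ball (0 : E3) a)
  rw [finrank_euclideanSpace_fin] at hcov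
  -- the rotation is absorbed by the rotation invariance of origin-centred ball integrals
  have hrot : ∫⁻ y in ball (0 : E3) L, ‖u τ₁ (x₀ + σ • twist S (Real.log s) y)‖ₑ ^ 2 =
      ∫⁻ z in ball (0 : E3) L, ‖u τ₁ (x₀ + σ • z)‖ₑ ^ 2 := by
    have h := Killing.setLIntegral_ball_comp_expSkew hSx (Real.log s) (fun z : E3 => ‖u τ₁ (x₀ + σ • z)‖ₑ ^ 2) L
    simpa [twist] using h
  have hmain : ENNReal.ofReal (s ^ (2 * (γ - 1))) * ∫⁻ y in ball (0 : E3) L, ‖V y‖ₑ ^ 2 ≤ ENNReal.ofReal (σ ^ 3)⁻¹ * I := by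
    rw [← hcov, ← lintegral_const_mul' _ _ ENNReal.ofReal_ne_top]
    calc ∫⁻ y in ball (0 : E3) L, ENNReal.ofReal (s ^ (2 * (γ - 1))) * ‖V y‖ₑ ^ 2
        = ∫⁻ y in ball (0 : E3) L, ‖u τ₁ (x₀ + σ • twist S (Real.log s) y)‖ₑ ^ 2 :=
          lintegral_congr fun y => (hval y).symm
      _ = ∫⁻ z in ball (0 : E3) L, ‖u τ₁ (x₀ + σ • z)‖ₑ ^ 2 := hrot
      _ ≤ ∫⁻ y in (fun y : E3 => x₀ + σ • y) ⁻¹' ball (0 : E3) a, ‖u τ₁ (x₀ + σ • y)‖ₑ ^ 2 := lintegral_mono_set hpre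
  -- ### assemble
  have haL' : a ^ (1 - 2 * ρ) ≤ (σ + ‖x₀‖) ^ (1 - 2 * ρ) * L ^ (1 - 2 * ρ) := by
    rw [← Real.mul_rpow (by positivity) hL0.le]
    refine Real.rpow_le_rpow ha0.le ?_ h12ρ
    have : ‖x₀‖ ≤ ‖x₀‖ * L := le_mul_of_one_le_right (norm_nonneg _) (by linarith)
    rw [ha]; nlinarith
  have hunit2 : ENNReal.ofReal (s ^ (2 - 2 * γ)) * ENNReal.ofReal (s ^ (2 * (γ - 1))) = 1 := by
    rw [← ENNReal.ofReal_mul (Real.rpow_nonneg hs0.le _), ← Real.rpow_add hs0,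
      show (2 - 2 * γ) + 2 * (γ - 1) = 0 by ring, Real.rpow_zero, ENNReal.ofReal_one]
  calc ∫⁻ y in ball (0 : E3) L, ‖V y‖ₑ ^ 2
      = ENNReal.ofReal (s ^ (2 - 2 * γ)) *
          (ENNReal.ofReal (s ^ (2 * (γ - 1))) * ∫⁻ y in ball (0 : E3) L, ‖V y‖ₑ ^ 2) := by
        rw [← mul_assoc, hunit2, one_mul]
    _ ≤ ENNReal.ofReal (s ^ (2 - 2 * γ)) * (ENNReal.ofReal (σ ^ 3)⁻¹ * I) := by gcongr
    _ ≤ ENNReal.ofReal (s ^ (2 - 2 * γ)) * (ENNReal.ofReal (σ ^ 3)⁻¹ *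
          (ENNReal.ofReal (a ^ (1 - 2 * ρ)) * (c : ℝ≥0∞))) := by gcongr
    _ ≤ ENNReal.ofReal (s ^ (2 - 2 * γ)) * (ENNReal.ofReal (σ ^ 3)⁻¹ *
          (ENNReal.ofReal ((σ + ‖x₀‖) ^ (1 - 2 * ρ) * L ^ (1 - 2 * ρ)) * (c : ℝ≥0∞))) := by
        gcongr
    _ = ENNReal.ofReal k * (c : ℝ≥0∞) * ENNReal.ofReal (L ^ (1 - 2 * ρ)) := by
        rw [hk, ENNReal.ofReal_mul (by positivity), ENNReal.ofReal_mul (by positivity),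
          ENNReal.ofReal_mul (by positivity)]
        ring

end SpiralGaugeA

section SpiralGaugeE

open Function TopologicalSpace
open Literature.Analysis.FunctionSpaces
open Summit.NavierStokesRegularity.NavierStokesRegularity.Theorems.PowerGaugeEulerLiouville

/-! ### R3a port, recipe step P3 (PROVED): the weak gradient of a spiral member and its `E`-gauge in profile variables -/

/-- The rotation clock at a fixed logarithmic time is a LINEAR ISOMETRY of `ℝ³`: for skew `S` there is `R : ℝ³ ≃ₗᵢ ℝ³` with
`R = e^{sS}` and `R⁻¹ = e^{−sS}` pointwise (`Literature…rss_exists_rot`). [folklore] -/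
theorem exists_twist_isometry {S : E3 →L[ℝ] E3} (hS : IsSkew S) (s : ℝ) :
    ∃ R : E3 ≃ₗᵢ[ℝ] E3, (∀ y : E3, R y = twist S s y) ∧ ∀ y : E3, R.symm y = twist S (-s) y := by
  have hSx : ∀ x : E3, ⟪S x, x⟫ = 0 := fun x => inner_skew_self hS x
  obtain ⟨L, hL, hL'⟩ := rss_exists_rot hSx s
  refine ⟨L.symm, fun y => ?_, fun y => ?_⟩
  · rw [hL' y]
  · rw [LinearIsometryEquiv.symm_symm, hL y]

/-- CLM algebra of the conjugation: if `R⁻¹ ∘ (k A) ∘ R = B` then `A = k⁻¹ • R ∘ B ∘ R⁻¹` (`k ≠ 0`). [folklore] -/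
theorem clm_eq_smul_conj_of_symm_conj_eq {R : E3 ≃ₗᵢ[ℝ] E3} {A B : E3 →L[ℝ] E3} {k : ℝ} (hk : k ≠ 0)
    (h : (R.symm : E3 →L[ℝ] E3).comp ((k • A).comp (R : E3 →L[ℝ] E3)) = B) :
    A = k⁻¹ • (R : E3 →L[ℝ] E3).comp (B.comp (R.symm : E3 →L[ℝ] E3)) := by
  rw [← h]
  ext1 v
  simp [smul_smul, inv_mul_cancel₀ hk]

/-- **P3 OF THE R3a PORT RECIPE, PROVED (part 1): IDENTIFICATION OF THE WEAK GRADIENT OF A SPIRAL MEMBER.**  The spiral version of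
`Past.exists_profileGradient_ae_of_past` (…SelfSimilarPastProfileGradient): if `H` is a weak spatial gradient of `u` on the slab and
`u(τ, x) = λ^{γ−1} e^{(log λ)S} V(e^{−(log λ)S} λ^{−γ}(x − x₀))` for `τ < T₁` (`λ = T − τ`, `γ = 1/(2+ρ)`, `T₁ ≤ 0`, `T₁ ≤ T`, `S` skew), then
there is a profile gradient `G` (a.e.-strongly measurable, a weak derivative of `V` on `ℝ³`) with, for a.e. `τ < T₁`,
`H(τ, x) = λ^{−1} · e^{(log λ)S} ∘ G(e^{−(log λ)S} λ^{−γ}(x − x₀)) ∘ e^{−(log λ)S}` for a.e. `x` — the weak form of the chain rule for the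
rotated affine chart.  Proof = the untwisted one with ONE extra step per slice: the slice is `x ↦ c • W(d • (x − x₀))` for the CONJUGATED
profile `W = R ∘ V ∘ R⁻¹` (`R = e^{(log λ)S}` a linear isometry, `exists_twist_isometry`), so `Past.hasWeakFDerivOn_profile_of_shiftedSlice`
differentiates `W` and `Twisted.hasWeakFDerivOn_conj R⁻¹` (tree, …PastTwistedTools) undoes the conjugation; uniqueness of weak derivatives
(`HasWeakFDerivOn.unique_holds`) and transport along the measure-class-preserving chart finish. [folklore] -/
theorem spiral_profileGradient_ae_of_past {ρ T T₁ : ℝ} (hT₁ : T₁ ≤ 0) (hTT₁ : T₁ ≤ T) (x₀ : E3)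
    {S : E3 →L[ℝ] E3} (hS : IsSkew S) {u : ℝ → E3 → E3} {V : E3 → E3} {H : ℝ → E3 → E3 →L[ℝ] E3}
    (hH : HasWeakSpatialGradientOn (slab (EuclideanSpace ℝ (Fin 3)) (Set.Iio 0) isOpen_Iio) u H)
    (hu : IsPastSpiral ρ T T₁ x₀ S u V) :
    ∃ G : E3 → E3 →L[ℝ] E3, AEStronglyMeasurable G volume ∧
      HasWeakFDerivOn (⊤ : TopologicalSpace.Opens E3) volume V G ∧
      ∀ᵐ τ ∂((volume : Measure ℝ).restrict (Iio T₁)), H τ =ᵐ[volume] fun x =>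
        (T - τ) ^ (-1 : ℝ) • (twist S (Real.log (T - τ))).comp
          ((G (twist S (-Real.log (T - τ)) ((T - τ) ^ (-(1 / (2 + ρ))) • (x - x₀)))).comp (twist S (-Real.log (T - τ)))) := by
  set γ : ℝ := 1 / (2 + ρ) with hγ
  -- (1) a.e. slice below `T₁` is a weak derivative on `ℝ³`, and is a.e.-strongly measurable
  have hslice : ∀ᵐ τ ∂((volume : Measure ℝ).restrict (Iio T₁)),
      HasWeakFDerivOn (⊤ : TopologicalSpace.Opens E3) volume (u τ) (H τ) :=
    FrameSteady.ae_hasWeakFDerivOn_slice_past hH hT₁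
  have hHm : AEStronglyMeasurable (Function.uncurry H)
      (((volume : Measure ℝ).restrict (Iio (0 : ℝ))).prod (volume : Measure E3)) := by
    have := hH.locallyIntegrableOn_grad.aestronglyMeasurable
    rw [coe_slab, Measure.volume_eq_prod, ← Measure.prod_restrict, Measure.restrict_univ] at this
    exact this
  have hmeas : ∀ᵐ τ ∂((volume : Measure ℝ).restrict (Iio T₁)), AEStronglyMeasurable (H τ) volume :=
    ae_restrict_of_ae_restrict_of_subset (Iio_subset_Iio hT₁) hHm.prodMk_left
  have hlt : ∀ᵐ τ ∂((volume : Measure ℝ).restrict (Iio T₁)), τ < T₁ := ae_restrict_mem measurableSet_Iio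
  haveI : (ae ((volume : Measure ℝ).restrict (Iio T₁))).NeBot := by
    rw [ae_neBot, Ne, Measure.restrict_eq_zero]
    simp
  -- (2) the slice in the ROTATED affine chart: `u τ = c • W(d • (· − x₀))`, `W = R ∘ V ∘ R⁻¹`
  have hchart : ∀ {τ : ℝ}, τ < T₁ → ∀ (R : E3 ≃ₗᵢ[ℝ] E3), (∀ y : E3, R y = twist S (Real.log (T - τ)) y) →
      (∀ y : E3, R.symm y = twist S (-Real.log (T - τ)) y) →
      u τ = fun x => (T - τ) ^ (γ - 1) • (fun z => R (V (R.symm z))) ((T - τ) ^ (-γ) • (x - x₀)) := by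
    intro τ hτ R hR hR'
    rw [hu τ hτ]
    funext x
    simp only [hR, hR', hγ]
  -- the weak derivative of `V` read off ONE good slice, conjugation undone
  have hderiv : ∀ {τ : ℝ}, τ < T₁ → HasWeakFDerivOn (⊤ : TopologicalSpace.Opens E3) volume (u τ) (H τ) →
      ∀ (R : E3 ≃ₗᵢ[ℝ] E3), (∀ y : E3, R y = twist S (Real.log (T - τ)) y) →
      (∀ y : E3, R.symm y = twist S (-Real.log (T - τ)) y) →
      HasWeakFDerivOn (⊤ : TopologicalSpace.Opens E3) volume V fun x =>
        (R.symm : E3 →L[ℝ] E3).comp ((((T - τ) ^ (γ - 1))⁻¹ • ((((T - τ) ^ (-γ)))⁻¹ •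
          H τ (x₀ + ((T - τ) ^ (-γ))⁻¹ • R x))).comp (R : E3 →L[ℝ] E3)) := by
    intro τ hτ hW R hR hR'
    have hs : 0 < T - τ := by linarith
    have hcp : 0 < (T - τ) ^ (γ - 1) := Real.rpow_pos_of_pos hs _
    have hdp : 0 < (T - τ) ^ (-γ) := Real.rpow_pos_of_pos hs _
    rw [hchart hτ R hR hR'] at hW
    have hK := Past.hasWeakFDerivOn_profile_of_shiftedSlice (V := fun z => R (V (R.symm z))) hcp hdp x₀ hW
    have hconj := Twisted.hasWeakFDerivOn_conj R.symm hK
    simp only [LinearIsometryEquiv.symm_symm, LinearIsometryEquiv.symm_apply_apply] at hconj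
    exact hconj
  obtain ⟨τ₀, ⟨hW₀, hm₀⟩, hτ₀⟩ := ((hslice.and hmeas).and hlt).exists
  obtain ⟨R₀, hR₀, hR₀'⟩ := exists_twist_isometry hS (Real.log (T - τ₀))
  have hs₀ : 0 < T - τ₀ := by linarith
  set c₀ : ℝ := (T - τ₀) ^ (γ - 1) with hc₀
  set d₀ : ℝ := (T - τ₀) ^ (-γ) with hd₀
  have hc₀p : 0 < c₀ := Real.rpow_pos_of_pos hs₀ _
  have hd₀p : 0 < d₀ := Real.rpow_pos_of_pos hs₀ _
  set G : E3 → E3 →L[ℝ] E3 := fun x =>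
    (R₀.symm : E3 →L[ℝ] E3).comp ((c₀⁻¹ • (d₀⁻¹ • H τ₀ (x₀ + d₀⁻¹ • R₀ x))).comp (R₀ : E3 →L[ℝ] E3)) with hG
  have hVG : HasWeakFDerivOn (⊤ : TopologicalSpace.Opens E3) volume V G := hderiv hτ₀ hW₀ R₀ hR₀ hR₀'
  have hGm : AEStronglyMeasurable G volume := by
    have hqmp : Measure.QuasiMeasurePreserving (fun x : E3 => x₀ + d₀⁻¹ • R₀ x) volume volume :=
      (Past.quasiMeasurePreserving_add_smul (inv_pos.2 hd₀p).ne' x₀).comp R₀.measurePreserving.quasiMeasurePreserving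
    have h1 : AEStronglyMeasurable (fun x => H τ₀ (x₀ + d₀⁻¹ • R₀ x)) volume := hm₀.comp_quasiMeasurePreserving hqmp
    have h2 : AEStronglyMeasurable (fun x => c₀⁻¹ • (d₀⁻¹ • H τ₀ (x₀ + d₀⁻¹ • R₀ x))) volume :=
      (h1.const_smul d₀⁻¹).const_smul c₀⁻¹
    exact (Twisted.continuous_conj R₀.symm).comp_aestronglyMeasurable h2 |>.congr (by
      filter_upwards with x; simp only [hG, LinearIsometryEquiv.symm_symm])
  refine ⟨G, hGm, hVG, ?_⟩
  -- (3) for every good `τ < T₁`: uniqueness of the weak derivative of `V`, transported along the rotated chart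
  filter_upwards [hslice, hlt] with τ hWτ hτ
  have hs : 0 < T - τ := by linarith
  obtain ⟨R, hR, hR'⟩ := exists_twist_isometry hS (Real.log (T - τ))
  have hcp : 0 < (T - τ) ^ (γ - 1) := Real.rpow_pos_of_pos hs _
  have hdp : 0 < (T - τ) ^ (-γ) := Real.rpow_pos_of_pos hs _
  have hVG' := hderiv hτ hWτ R hR hR'
  have huniq := HasWeakFDerivOn.unique_holds hVG' hVG
  rw [TopologicalSpace.Opens.coe_top, Measure.restrict_univ] at huniq
  have hqmp : Measure.QuasiMeasurePreserving (fun x : E3 => R.symm ((T - τ) ^ (-γ) • (x - x₀))) volume volume :=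
    R.symm.measurePreserving.quasiMeasurePreserving.comp (Past.quasiMeasurePreserving_smul_sub hdp.ne' x₀)
  have ht := hqmp.ae_eq_comp huniq
  filter_upwards [ht] with x hx
  simp only [Function.comp_apply, LinearIsometryEquiv.apply_symm_apply, smul_smul, inv_mul_cancel₀ hdp.ne', one_smul,
    add_sub_cancel] at hx
  -- `hx : R⁻¹ ∘ ((c⁻¹ d⁻¹) H τ x) ∘ R = G (R⁻¹ (d (x − x₀)))`, `c = λ^{γ−1}`, `d = λ^{−γ}`
  have hk : ((T - τ) ^ (γ - 1))⁻¹ * ((T - τ) ^ (-γ))⁻¹ ≠ 0 := mul_ne_zero (inv_ne_zero hcp.ne') (inv_ne_zero hdp.ne')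
  have hcd : (((T - τ) ^ (γ - 1))⁻¹ * ((T - τ) ^ (-γ))⁻¹)⁻¹ = (T - τ) ^ (-1 : ℝ) := by
    rw [mul_inv, inv_inv, inv_inv, ← Real.rpow_add hs]
    congr 1; ring
  have hRc : (R : E3 →L[ℝ] E3) = twist S (Real.log (T - τ)) := by
    ext1 y; simpa using hR y
  have hRc' : (R.symm : E3 →L[ℝ] E3) = twist S (-Real.log (T - τ)) := by
    ext1 y; simpa using hR' y
  rw [clm_eq_smul_conj_of_symm_conj_eq hk hx, hcd, hRc, hRc', hR']

/-- **P3 OF THE R3a PORT RECIPE, PROVED (part 2): THE `E`-GAUGE OF A SPIRAL MEMBER IN PROFILE VARIABLES (large scales).**  The spiral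
version of `Past.profile_gradient_growth_of_gaugeE_past` (…SelfSimilarPastProfileDissipation), same threshold `L ≥ 2 − T₁`, same constant
`C = Λ^{2−3γ}(Λ^{γ} + ‖x₀‖)^{1−ρ} c` (`Λ = T − T₁ + 2`): if `H` is a.e.-strongly measurable on the slab with the SPIRAL gradient identity of
`spiral_profileGradient_ae_of_past` for a.e. `τ < T₁`, and `a^{ρ} E(a; 0; H) ≤ c` for all `a > 0`, then `∫_{B_L} |G|²_F ≤ C L^{1−ρ}` for every
`L ≥ 2 − T₁`.  The proof is the untwisted one VERBATIM except on each slice of the window, where the conjugation `e^{(log λ)S} ∘ · ∘ e^{−(log λ)S}`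
is killed by the conjugation invariance of the Frobenius norm (`frobeniusNormSq_conj_linearIsometryEquiv`), the tree's per-slice lower bound
`Past.lintegral_ball_frobeniusNormSq_shiftedGradient_ge` is applied to the ROTATED profile gradient `G ∘ e^{−(log λ)S}`, and the rotation is
absorbed by `Killing.setLIntegral_ball_comp_expSkew` (origin-centred balls are rotation invariant) — KEY ALGEBRA (i) of the recipe again. [folklore] -/
theorem spiral_gradient_growth_of_gaugeE_past {ρ : ℝ} (hρ : 0 < ρ) (hρ1 : ρ < 1)
    {T T₁ : ℝ} (hT₁ : T₁ ≤ 0) (hTT₁ : T₁ ≤ T) (x₀ : E3) {S : E3 →L[ℝ] E3} (hS : IsSkew S)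
    {H : ℝ → E3 → E3 →L[ℝ] E3} {G : E3 → E3 →L[ℝ] E3} {c : ℝ≥0}
    (hHm : AEStronglyMeasurable (Function.uncurry H) (volume.restrict (Iio (0 : ℝ) ×ˢ (univ : Set E3))))
    (hH : ∀ᵐ τ ∂((volume : Measure ℝ).restrict (Iio T₁)), H τ =ᵐ[volume] fun x =>
        (T - τ) ^ (-1 : ℝ) • (twist S (Real.log (T - τ))).comp
          ((G (twist S (-Real.log (T - τ)) ((T - τ) ^ (-(1 / (2 + ρ))) • (x - x₀)))).comp (twist S (-Real.log (T - τ)))))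
    (hE : ∀ a : ℝ, 0 < a → ENNReal.ofReal (a ^ ρ) * cknE a (0 : ℝ × E3) H ≤ (c : ℝ≥0∞)) :
    ∃ C : ℝ≥0∞, C ≠ ⊤ ∧ ∀ L : ℝ, 2 - T₁ ≤ L →
      ∫⁻ y in ball (0 : E3) L, ENNReal.ofReal (frobeniusNormSq (G y)) ≤ C * ENNReal.ofReal (L ^ (1 - ρ)) := by
  have hSx : ∀ x : E3, ⟪S x, x⟫ = 0 := fun x => inner_skew_self hS x
  set γ : ℝ := 1 / (2 + ρ) with hγ
  have h2ρ : 0 < 2 + ρ := by linarith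
  have hγ0 : 0 < γ := by rw [hγ]; positivity
  have hγ23 : 3 * γ - 2 ≤ 0 := by
    have : γ ≤ 1 / 2 := by
      rw [hγ, div_le_div_iff₀ h2ρ two_pos]; linarith
    linarith
  have h1ρ : 0 ≤ 1 - ρ := by linarith
  have hfm : Measurable fun L : E3 →L[ℝ] E3 => ENNReal.ofReal (frobeniusNormSq L) :=
    (SereginZajaczkowski2007.continuous_frobeniusNormSq).measurable.ennreal_ofReal
  -- the time scale `Λ = T − T₁ + 2` of the window `(T₁ − 2, T₁ − 1)` and the constant
  set Λ : ℝ := T - T₁ + 2 with hΛ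
  have hΛ2 : 2 ≤ Λ := by rw [hΛ]; linarith
  have hΛ0 : 0 < Λ := by linarith
  set σ : ℝ := Λ ^ γ with hσ
  have hσ0 : 0 < σ := Real.rpow_pos_of_pos hΛ0 _
  have hσ1 : 1 ≤ σ := Real.one_le_rpow (by linarith) hγ0.le
  set k : ℝ := Λ ^ (2 - 3 * γ) * (σ + ‖x₀‖) ^ (1 - ρ) with hk
  refine ⟨ENNReal.ofReal k * (c : ℝ≥0∞), ENNReal.mul_ne_top ENNReal.ofReal_ne_top ENNReal.coe_ne_top,
    fun L hL => ?_⟩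
  have hL2 : 2 ≤ L := by linarith
  have hL0 : 0 < L := by linarith
  -- ### the radius `a = σ L + ‖x₀‖`
  set a : ℝ := σ * L + ‖x₀‖ with ha
  have haL : L ≤ a := by
    have : 1 * L ≤ σ * L := mul_le_mul_of_nonneg_right hσ1 hL0.le
    have := norm_nonneg x₀
    rw [ha]; linarith
  have ha0 : 0 < a := by linarith
  have ha2 : 2 - T₁ ≤ a ^ 2 := by nlinarith
  -- ### (1) the gauge: `X = ∫∫_{Q_a} |H|²_F ≤ a^{1−ρ} c`
  set X : ℝ≥0∞ := ∫⁻ q in parabolicCylinder a (0 : ℝ × E3), ENNReal.ofReal (frobeniusNormSq (H q.1 q.2)) with hX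
  have hXle : X ≤ ENNReal.ofReal (a ^ (1 - ρ)) * (c : ℝ≥0∞) := by
    have h1 := hE a ha0
    unfold cknE at h1
    have hB0 : ENNReal.ofReal (a ^ ρ) ≠ 0 := by
      rw [ENNReal.ofReal_ne_zero_iff]; exact Real.rpow_pos_of_pos ha0 _
    have hA0 : ENNReal.ofReal a ≠ 0 := by rw [ENNReal.ofReal_ne_zero_iff]; exact ha0
    have key : X = ENNReal.ofReal a * (ENNReal.ofReal (a ^ ρ))⁻¹ *
        (ENNReal.ofReal (a ^ ρ) * ((ENNReal.ofReal a)⁻¹ * X)) := by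
      rw [← mul_assoc, mul_assoc (ENNReal.ofReal a), ENNReal.inv_mul_cancel hB0 ENNReal.ofReal_ne_top,
        mul_one, ← mul_assoc, ENNReal.mul_inv_cancel hA0 ENNReal.ofReal_ne_top, one_mul]
    calc X = _ := key
      _ ≤ ENNReal.ofReal a * (ENNReal.ofReal (a ^ ρ))⁻¹ * (c : ℝ≥0∞) := by gcongr
      _ = ENNReal.ofReal (a ^ (1 - ρ)) * (c : ℝ≥0∞) := by
          rw [← ENNReal.ofReal_inv_of_pos (Real.rpow_pos_of_pos ha0 _), ← ENNReal.ofReal_mul ha0.le]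
          congr 2
          rw [Real.rpow_sub ha0, Real.rpow_one, div_eq_mul_inv]
  -- ### (2) the window `(T₁ − 2, T₁ − 1) × B_a` inside `Q_a(0,0)`
  have hWsub : Ioo (T₁ - 2) (T₁ - 1) ×ˢ ball (0 : E3) a ⊆ parabolicCylinder a (0 : ℝ × E3) := by
    intro q hq
    rw [mem_prod, mem_Ioo, mem_ball] at hq
    rw [mem_parabolicCylinder, Prod.fst_zero, Prod.snd_zero, zero_sub]
    exact ⟨⟨by linarith [hq.1.1], by linarith [hq.1.2]⟩, hq.2⟩
  have hY : ∫⁻ q in Ioo (T₁ - 2) (T₁ - 1) ×ˢ ball (0 : E3) a, ENNReal.ofReal (frobeniusNormSq (H q.1 q.2)) ≤ X :=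
    lintegral_mono_set hWsub
  -- ### (3) Tonelli on the window
  have hHmW : AEMeasurable (fun q : ℝ × E3 => ENNReal.ofReal (frobeniusNormSq (H q.1 q.2)))
      (((volume : Measure ℝ).restrict (Ioo (T₁ - 2) (T₁ - 1))).prod ((volume : Measure E3).restrict (ball 0 a))) := by
    have hsub : Ioo (T₁ - 2) (T₁ - 1) ×ˢ ball (0 : E3) a ⊆ Iio (0 : ℝ) ×ˢ (univ : Set E3) :=
      prod_mono (fun t ht => by have := ht.2; rw [mem_Iio]; linarith) (subset_univ _)
    have := hfm.comp_aemeasurable (hHm.mono_measure (Measure.restrict_mono hsub le_rfl)).aemeasurable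
    rwa [Measure.volume_eq_prod, ← Measure.prod_restrict] at this
  have hYeq : ∫⁻ q in Ioo (T₁ - 2) (T₁ - 1) ×ˢ ball (0 : E3) a, ENNReal.ofReal (frobeniusNormSq (H q.1 q.2)) =
      ∫⁻ τ in Ioo (T₁ - 2) (T₁ - 1), ∫⁻ x in ball (0 : E3) a, ENNReal.ofReal (frobeniusNormSq (H τ x)) := by
    rw [Measure.volume_eq_prod, ← Measure.prod_restrict, lintegral_prod _ hHmW]
  -- ### (4) the a.e. lower bound on the slices of the window — the only place where the TWIST enters, and leaves
  set J : ℝ≥0∞ := ∫⁻ y in ball (0 : E3) L, ENNReal.ofReal (frobeniusNormSq (G y)) with hJ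
  have hWT : Ioo (T₁ - 2) (T₁ - 1) ⊆ Iio T₁ := fun t ht => by have := ht.2; rw [mem_Iio]; linarith
  have hlow : ∀ᵐ τ ∂((volume : Measure ℝ).restrict (Ioo (T₁ - 2) (T₁ - 1))),
      ENNReal.ofReal (Λ ^ (3 * γ - 2)) * J ≤ ∫⁻ x in ball (0 : E3) a, ENNReal.ofReal (frobeniusNormSq (H τ x)) := by
    filter_upwards [ae_restrict_of_ae_restrict_of_subset hWT hH, ae_restrict_mem measurableSet_Ioo] with τ hτ hτW
    have hs : 0 < T - τ := by have := hτW.2; linarith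
    have hsΛ : T - τ ≤ Λ := by have := hτW.1; rw [hΛ]; linarith
    obtain ⟨R, hR, hR'⟩ := exists_twist_isometry hS (Real.log (T - τ))
    have hRc : (R : E3 →L[ℝ] E3) = twist S (Real.log (T - τ)) := by
      ext1 y; simpa using hR y
    have hRc' : (R.symm : E3 →L[ℝ] E3) = twist S (-Real.log (T - τ)) := by
      ext1 y; simpa using hR' y
    -- replace `H τ` by the spiral gradient on the ball; the conjugation is invisible to the Frobenius norm
    have hcongr : ∫⁻ x in ball (0 : E3) a, ENNReal.ofReal (frobeniusNormSq (H τ x)) =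
        ∫⁻ x in ball (0 : E3) a, ENNReal.ofReal (frobeniusNormSq
          ((T - τ) ^ (-1 : ℝ) • (fun z => G (R.symm z)) ((T - τ) ^ (-γ) • (x - x₀)))) := by
      refine lintegral_congr_ae (ae_restrict_of_ae (hτ.mono fun x hx => ?_))
      show ENNReal.ofReal (frobeniusNormSq (H τ x)) =
        ENNReal.ofReal (frobeniusNormSq ((T - τ) ^ (-1 : ℝ) • G (R.symm ((T - τ) ^ (-γ) • (x - x₀)))))
      rw [hx, ← hRc, ← hRc']
      simp only [LinearIsometryEquiv.coe_coe'', frobeniusNormSq_smul, frobeniusNormSq_conj_linearIsometryEquiv]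
    rw [hcongr]
    have hLa : (T - τ) ^ γ * L + ‖x₀‖ ≤ a := by
      have : (T - τ) ^ γ ≤ σ := Real.rpow_le_rpow hs.le hsΛ hγ0.le
      rw [ha]; nlinarith
    -- the rotated profile gradient has the same ball integrals
    have hrot : ∫⁻ y in ball (0 : E3) L, ENNReal.ofReal (frobeniusNormSq ((fun z => G (R.symm z)) y)) = J := by
      have h := Killing.setLIntegral_ball_comp_expSkew hSx (-Real.log (T - τ))
        (fun z : E3 => ENNReal.ofReal (frobeniusNormSq (G z))) L
      simpa [hR', twist] using h
    calc ENNReal.ofReal (Λ ^ (3 * γ - 2)) * J ≤ ENNReal.ofReal ((T - τ) ^ (3 * γ - 2)) * J :=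
          mul_le_mul' (ENNReal.ofReal_le_ofReal (Real.rpow_le_rpow_of_nonpos hs hsΛ hγ23)) le_rfl
      _ = ENNReal.ofReal ((T - τ) ^ (3 * γ - 2)) *
            ∫⁻ y in ball (0 : E3) L, ENNReal.ofReal (frobeniusNormSq ((fun z => G (R.symm z)) y)) := by rw [hrot]
      _ ≤ _ := Past.lintegral_ball_frobeniusNormSq_shiftedGradient_ge γ hs x₀ (fun z => G (R.symm z)) hLa
  -- ### (5) integrate the lower bound over the window (length `1`)
  have hvolW : volume (Ioo (T₁ - 2) (T₁ - 1)) = 1 := by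
    rw [Real.volume_Ioo, show T₁ - 1 - (T₁ - 2) = (1 : ℝ) by ring, ENNReal.ofReal_one]
  have hJle : ENNReal.ofReal (Λ ^ (3 * γ - 2)) * J ≤ X :=
    calc ENNReal.ofReal (Λ ^ (3 * γ - 2)) * J
        = ∫⁻ _ in Ioo (T₁ - 2) (T₁ - 1), ENNReal.ofReal (Λ ^ (3 * γ - 2)) * J := by
          rw [setLIntegral_const, hvolW, mul_one]
      _ ≤ ∫⁻ τ in Ioo (T₁ - 2) (T₁ - 1), ∫⁻ x in ball (0 : E3) a, ENNReal.ofReal (frobeniusNormSq (H τ x)) :=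
          lintegral_mono_ae hlow
      _ = _ := hYeq.symm
      _ ≤ X := hY
  -- ### (6) assemble
  have haL' : a ^ (1 - ρ) ≤ (σ + ‖x₀‖) ^ (1 - ρ) * L ^ (1 - ρ) := by
    rw [← Real.mul_rpow (by positivity) hL0.le]
    refine Real.rpow_le_rpow ha0.le ?_ h1ρ
    have : ‖x₀‖ ≤ ‖x₀‖ * L := le_mul_of_one_le_right (norm_nonneg _) (by linarith)
    rw [ha]; nlinarith
  have hunit : ENNReal.ofReal (Λ ^ (2 - 3 * γ)) * ENNReal.ofReal (Λ ^ (3 * γ - 2)) = 1 := by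
    rw [← ENNReal.ofReal_mul (Real.rpow_nonneg hΛ0.le _), ← Real.rpow_add hΛ0,
      show (2 - 3 * γ) + (3 * γ - 2) = 0 by ring, Real.rpow_zero, ENNReal.ofReal_one]
  calc J = ENNReal.ofReal (Λ ^ (2 - 3 * γ)) * (ENNReal.ofReal (Λ ^ (3 * γ - 2)) * J) := by
        rw [← mul_assoc, hunit, one_mul]
    _ ≤ ENNReal.ofReal (Λ ^ (2 - 3 * γ)) * X := by gcongr
    _ ≤ ENNReal.ofReal (Λ ^ (2 - 3 * γ)) * (ENNReal.ofReal (a ^ (1 - ρ)) * (c : ℝ≥0∞)) := by gcongr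
    _ ≤ ENNReal.ofReal (Λ ^ (2 - 3 * γ)) * (ENNReal.ofReal ((σ + ‖x₀‖) ^ (1 - ρ) * L ^ (1 - ρ)) * (c : ℝ≥0∞)) := by gcongr
    _ = ENNReal.ofReal k * (c : ℝ≥0∞) * ENNReal.ofReal (L ^ (1 - ρ)) := by
        rw [hk, ENNReal.ofReal_mul (by positivity), ENNReal.ofReal_mul (by positivity)]
        ring

/-- **P3 AT THE MEMBER LEVEL (parts 1 + 2): profile gradient of a spiral member with large-scale dissipation growth.**  For a member of the class
(only the weak-gradient clause and the `E`-gauge clause are used) whose velocity is a Perelman spiral about `(T, x₀)` with skew generator `S` and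
profile `V` for `τ < T₁` (`T₁ ≤ 0`, `T₁ ≤ T`, `0 < ρ < 1`): there is a profile gradient `G` — a.e.-strongly measurable, a weak derivative of `V` on
`ℝ³`, with the spiral gradient identity a.e. — and `C < ∞` with `∫_{B_L}|G|²_F ≤ C L^{1−ρ}` for every `L ≥ 2 − T₁`.  The spiral twin of the tree's
`Past.exists_profileGradient_growth_of_past`; with `spiral_energy_growth_of_gaugeA_past` (REV5) this is (A₁)+(E₁) of `Sig.stub_spiralLocData` up
to the harmless change of threshold/constant (`L ≥ 1` is reached as in `Past.exists_locData_of_past`, by monotonicity in `L` on `[1, 2 − T₁]`). [folklore] -/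
theorem spiral_profileGradient_growth_of_past {ρ : ℝ} (hρ : 0 < ρ) (hρ1 : ρ < 1)
    {T T₁ : ℝ} (hT₁ : T₁ ≤ 0) (hTT₁ : T₁ ≤ T) (x₀ : E3) {S : E3 →L[ℝ] E3} (hS : IsSkew S)
    {u : ℝ → E3 → E3} {V : E3 → E3} {H : ℝ → E3 → E3 →L[ℝ] E3} {c : ℝ≥0}
    (hH : HasWeakSpatialGradientOn (slab (EuclideanSpace ℝ (Fin 3)) (Set.Iio 0) isOpen_Iio) u H)
    (hu : IsPastSpiral ρ T T₁ x₀ S u V)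
    (hE : ∀ a : ℝ, 0 < a → ENNReal.ofReal (a ^ ρ) * cknE a (0 : ℝ × E3) H ≤ (c : ℝ≥0∞)) :
    ∃ G : E3 → E3 →L[ℝ] E3, AEStronglyMeasurable G volume ∧
      HasWeakFDerivOn (⊤ : TopologicalSpace.Opens E3) volume V G ∧
      (∀ᵐ τ ∂((volume : Measure ℝ).restrict (Iio T₁)), H τ =ᵐ[volume] fun x =>
        (T - τ) ^ (-1 : ℝ) • (twist S (Real.log (T - τ))).comp
          ((G (twist S (-Real.log (T - τ)) ((T - τ) ^ (-(1 / (2 + ρ))) • (x - x₀)))).comp (twist S (-Real.log (T - τ))))) ∧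
      ∃ C : ℝ≥0∞, C ≠ ⊤ ∧ ∀ L : ℝ, 2 - T₁ ≤ L →
        ∫⁻ y in ball (0 : E3) L, ENNReal.ofReal (frobeniusNormSq (G y)) ≤ C * ENNReal.ofReal (L ^ (1 - ρ)) := by
  obtain ⟨G, hGm, hVG, hae⟩ := spiral_profileGradient_ae_of_past hT₁ hTT₁ x₀ hS hH hu
  have hHm : AEStronglyMeasurable (Function.uncurry H) (volume.restrict (Iio (0 : ℝ) ×ˢ (univ : Set E3))) := by
    have := hH.locallyIntegrableOn_grad.aestronglyMeasurable
    simpa [slab] using this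
  exact ⟨G, hGm, hVG, hae, spiral_gradient_growth_of_gaugeE_past hρ hρ1 hT₁ hTT₁ x₀ hS hHm hae hE⟩

end SpiralGaugeE


/-- DICTIONARY: a steady past (the LEAD's `IsPastSteady`) is a relative equilibrium with the constant isometry path. -/
theorem isPastTwistedSteady_of_pastSteady {u : ℝ → E3 → E3}
    (h : ∃ T₁ : ℝ, T₁ ≤ 0 ∧ ∃ v : E3 → E3, ∀ τ : ℝ, τ < T₁ → u τ = v) : IsPastTwistedSteady u := by
  obtain ⟨T₁, hT₁, v, hv⟩ := h
  refine ⟨T₁, v, fun _ => LinearIsometryEquiv.refl ℝ E3, hT₁, fun τ hτ => ?_⟩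
  rw [hv τ hτ]
  rfl

/-- DICTIONARY: a time-periodic past (`u(τ − P) = u(τ)` for `τ < T₁`, the v30 branch of the LEAD's `IsWeakTamePast`) is a relative
periodic orbit with the trivial isometry. -/
theorem isPastTwistedPeriodic_of_pastTimePeriodic {u : ℝ → E3 → E3}
    (h : ∃ T₁ P : ℝ, T₁ ≤ 0 ∧ 0 < P ∧ ∀ τ : ℝ, τ < T₁ → u (τ - P) = u τ) : IsPastTwistedPeriodic u := by
  obtain ⟨T₁, P, hT₁, hP, hper⟩ := h
  refine ⟨T₁, P, LinearIsometryEquiv.refl ℝ E3, hT₁, hP, fun τ hτ => ?_⟩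
  rw [← hper τ hτ]
  rfl

/-- Dictionary: at `S = 0` the spiral wind is the Literature's similarity transport field `γy + V`. -/
theorem spiralWind_zero (γ : ℝ) (V : E3 → E3) : spiralWind γ 0 V = selfSimilarTransport γ 0 V := by
  funext y
  simp [spiralWind, selfSimilarTransport_apply, add_comm]

end Summit.NavierStokesRegularity.NavierStokesRegularity.Cruxes.PowerGaugeEulerLiouville.RelativeEquilibria

end
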